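import Mathlib
import Literature.NumberTheory.Automorphic.SelbergTransformProofs

/-!
# Uniform decay of the transform of the lattice kernel on the critical line: Iwaniec (12.9)
(Iwaniec, *Spectral Methods of Automorphic Forms*, GSM 53, (12.9) and proof of Theorem 12.1, PDF p. 126)

Seventh layer of the `provefact` decomposition of `Literature.NumberTheory.Automorphic.sl2BallCount_asymp`: the **discharge of the
named fact `Iwaniec2002_eq_12_9`** of `SelbergTransform.lean` ("we let the reader prove"): for
`X ≥ 2Y ≥ 2` and real `t` (`s = 1/2 + it`, `T = X/Y`) the Selberg/Harish-Chandra transform `h` of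
the kernel `k = k_{X,Y}` of Fig. 11 satisfies
`h(t) ≪ |s|^{-5/2} (min{|s|, T} + log X) X^{1/2}` with an absolute implied constant (here
`1440 √2`). Everything in this file is proved; the auxiliary analysis lives in the sub-namespace
`Literature.SelbergDecay` (continuing `SelbergTransformProofs.lean`).

## The argument

By the closed form `h(t) = (16/(3√2 Y))(F_{R_b}(t) - F_{R_a}(t))` (`selbergTransform_latticeKernel`,
`cosh R_a = X/2`, `cosh R_b = (X+Y)/2`, `F_R(t) = ∫_{-R}^{R} e^{irt}(cosh R - cosh r)^{3/2} dr`)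
everything reduces to estimates for the single special function `F_R` that are *uniform in `R`*.
The exact factorisation `cosh R - cosh r = (e^R/2)(1 - e^{r-R})(1 - e^{-r-R})` gives, in the
shifted variable `ρ = r + R ∈ [0, 2R]`,
`F_R(t) = (e^R/2)^{3/2} e^{-iRt} ∫_0^{2R} e^{iρt} M(ρ) M(2R - ρ) dρ` with `M(x) = (1 - e^{-x})^{3/2}`
(`coshKernelFourier_eq_P3`), and likewise `G_R(t) = ∫_{-R}^{R} e^{irt}(cosh R - cosh r)^{1/2} dr =
(e^R/2)^{1/2} e^{-iRt} ∫_0^{2R} e^{iρt} m(ρ) m(2R - ρ) dρ` with `m(x) = (1 - e^{-x})^{1/2}`.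

1. Elementary inequalities (`x e^{-x} ≤ 1`, `√x e^{-x} ≤ 1/2`, …) and `rpow` bookkeeping
   (sections 1–2).
2. The profiles `m`, `M = m³` and their first three derivatives on `(0, ∞)` with the uniform bounds
   `|m′| ≤ x^{-1/2}/2`, `|m″| ≤ (3/4) x^{-3/2}`, `|M″| ≤ (3/2) x^{-1/2}`, `|M‴| ≤ (33/8) x^{-3/2}`
   (section 3).
3. **The core oscillatory lemma** (`norm_integral_cexp_mul_singular_le`, section 4): if
   `|φ| ≤ A x^{-1/2}`, `|φ′| ≤ A′ x^{-3/2}` on `(0, ∞)` and `|ψ| ≤ B`, `∫_0^L |ψ′| ≤ V`, then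
   `|∫_0^L e^{ixt} φ ψ| ≤ (4AB + 2A′B + AV)|t|^{-1/2}` for `|t| ≥ 1`, uniformly in `L` (split at
   `δ = 1/|t|`, trivially on `[0, δ]`, by parts on `[δ, L]`).
4. One integration by parts (no boundary terms as `m(0) = 0`) and the core lemma with `φ = m′`:
   `|∫_0^L e^{ixt} m(x) m(L - x) dx| ≤ 8|t|^{-3/2}` (`norm_integral_cexp_pHalf_le`, section 5).
5. Two integrations by parts (`M(0) = M′(0) = 0`), the identity
   `M′(x) M′(L - x) = (9/4) e^{-L} m(x) m(L - x)` for the cross term and the core lemma with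
   `φ = M″`: `|∫_0^L e^{ixt} M(x) M(L - x) dx| ≤ (135/2)|t|^{-5/2}` (`norm_integral_cexp_P3_le`,
   section 6).
6. Hence, uniformly in `R ≥ 0` and for real `|t| ≥ 1`: `|F_R(t)| ≤ (135/2)(e^R/2)^{3/2}|t|^{-5/2}`,
   `|G_R(t)| ≤ 8 (e^R/2)^{1/2}|t|^{-3/2}`, and `|G_R(t)| ≤ 2R (e^R/2)^{1/2}` for all real `t`
   (section 7).
7. `Φ_C(t) = ∫ e^{irt}(C - cosh r)_+^{3/2} dr = F_{arcosh C}(t)` has `∂Φ_C/∂C = (3/2) 𝒢_C` with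
   `𝒢_C = G_{arcosh C}` (differentiation under the integral sign, `hasDerivAt_PhiC`, section 8), so
   the mean value inequality on `C ∈ [X/2, (X+Y)/2]` (length `Y/2`) together with
   `e^{arcosh C} ≤ 2C ≤ 2X` (section 9) gives `|h(t)| ≤ 16√2 X^{1/2} |t|^{-3/2}` for `|t| ≥ 1` and
   `|h(t)| ≤ 32√2 X^{1/2} log X` for `|t| ≤ 1` (the terms `|s|` and `log X` of (12.9), used when
   `|s| ≤ T`), while 6 applied to `F_{R_a}`, `F_{R_b}` separately gives
   `|h(t)| ≤ 360√2 (X/Y) X^{1/2}|t|^{-5/2}` (the term `T`, used when `|s| > T ≥ 2`); finally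
   `|t|^{p} ≤ 4|s|^{p}` for `-3 ≤ p ≤ 0`, `|t| ≥ 1` (section 10).
8. `Iwaniec2002_eq_12_9_holds : Iwaniec2002_eq_12_9` (section 11).

With this file the hypotheses of `Iwaniec2002_thm_12_1_of` / `sl2BallCount_asymp_of'`
(`AutomorphicKernel.lean`) coming from Chapters 1 and 12 are all discharged; what remains named
are the spectral inputs: (12.5) (`Iwaniec2002_eq_12_5`, the pretrace formula Thm 7.4 with the
local Weyl law (7.10)) and Cor. 11.5 (`Iwaniec2002_modular_smallSpectrum`).

Held copy: `book:iwaniec2002-spectral-methods-automorphic-forms`. Mathlib: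
`intervalIntegral.integral_mul_deriv_eq_deriv_mul_of_hasDerivAt`, `integral_rpow`,
`hasDerivAt_integral_of_dominated_loc_of_deriv_le`, `norm_image_sub_le_of_norm_deriv_le_segment'`;
no oscillatory-integral lemma with endpoint singularities in Mathlib or Literature (the van der
Corput material of `Literature/NumberTheory/LFunctions/VanDerCorputZeta.lean` treats exponential
*sums*; Mathlib's Fourier-transform decay is Riemann–Lebesgue without rates).
-/

noncomputable section

namespace Literature.NumberTheory.Automorphic

open MeasureTheory Set Filter Real intervalIntegral
open scoped Topology

namespace SelbergDecay


/-! ## 1. Elementary exponential inequalities -/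

/-- `x ≤ e^{x/2}` for `x ≥ 0` (from `e^{x/4} ≥ 1 + x/4` and `(1 + x/4)² ≥ x`). [folklore] -/
theorem le_exp_half {x : ℝ} (hx : 0 ≤ x) : x ≤ Real.exp (x / 2) := by
  have h1 : 1 + x / 4 ≤ Real.exp (x / 4) := by linarith [Real.add_one_le_exp (x / 4)]
  have h2 : Real.exp (x / 2) = Real.exp (x / 4) ^ 2 := by
    rw [← Real.exp_nat_mul]; congr 1; push_cast; ring
  rw [h2]
  have h3 : 0 ≤ 1 + x / 4 := by linarith
  calc x ≤ (1 + x / 4) ^ 2 := by nlinarith [sq_nonneg (1 - x / 4)]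
    _ ≤ Real.exp (x / 4) ^ 2 := pow_le_pow_left₀ h3 h1 2

/-- `x e^{-x/2} ≤ 1` for `x ≥ 0`. [folklore] -/
theorem mul_exp_neg_half_le_one {x : ℝ} (hx : 0 ≤ x) : x * Real.exp (-(x / 2)) ≤ 1 := by
  have h := le_exp_half hx
  have hpos := Real.exp_pos (-(x / 2))
  calc x * Real.exp (-(x / 2)) ≤ Real.exp (x / 2) * Real.exp (-(x / 2)) :=
        mul_le_mul_of_nonneg_right h hpos.le
    _ = 1 := by rw [← Real.exp_add, add_neg_cancel, Real.exp_zero]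

/-- `x e^{-x} ≤ 1`. [folklore] -/
theorem mul_exp_neg_le_one (x : ℝ) : x * Real.exp (-x) ≤ 1 := by
  have h : x ≤ Real.exp x := by linarith [Real.add_one_le_exp x]
  have hpos := Real.exp_pos (-x)
  calc x * Real.exp (-x) ≤ Real.exp x * Real.exp (-x) := mul_le_mul_of_nonneg_right h hpos.le
    _ = 1 := by rw [← Real.exp_add, add_neg_cancel, Real.exp_zero]

/-- `√x ≤ e^{x/2}` for `x ≥ 0` (`2√x ≤ 1 + x ≤ 2 e^{x/2}`). [folklore] -/
theorem sqrt_le_exp_half {x : ℝ} (hx : 0 ≤ x) : Real.sqrt x ≤ Real.exp (x / 2) := by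
  have h1 : Real.sqrt x ≤ (1 + x) / 2 := by
    nlinarith [sq_nonneg (Real.sqrt x - 1), Real.sq_sqrt hx, Real.sqrt_nonneg x]
  have h2 : 1 + x / 2 ≤ Real.exp (x / 2) := by linarith [Real.add_one_le_exp (x / 2)]
  linarith

/-- `√x e^{-x} ≤ 1/2` for `x ≥ 0`. [folklore] -/
theorem sqrt_mul_exp_neg_le_half {x : ℝ} (hx : 0 ≤ x) : Real.sqrt x * Real.exp (-x) ≤ 1 / 2 := by
  have h1 : Real.sqrt x ≤ (1 + x) / 2 := by
    nlinarith [sq_nonneg (Real.sqrt x - 1), Real.sq_sqrt hx, Real.sqrt_nonneg x]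
  have h2 : 1 + x ≤ Real.exp x := by linarith [Real.add_one_le_exp x]
  have hpos := Real.exp_pos (-x)
  calc Real.sqrt x * Real.exp (-x) ≤ (1 + x) / 2 * Real.exp (-x) :=
        mul_le_mul_of_nonneg_right h1 hpos.le
    _ ≤ Real.exp x / 2 * Real.exp (-x) := by gcongr
    _ = 1 / 2 := by
        rw [div_mul_eq_mul_div, ← Real.exp_add, add_neg_cancel, Real.exp_zero]

/-- `x^{3/2} e^{-x} ≤ 1` for `x ≥ 0`, as `x √x e^{-x} ≤ 1`. [folklore] -/
theorem mul_sqrt_mul_exp_neg_le_one {x : ℝ} (hx : 0 ≤ x) : x * Real.sqrt x * Real.exp (-x) ≤ 1 := by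
  have h1 := le_exp_half hx
  have h2 := sqrt_le_exp_half hx
  have hpos := Real.exp_pos (-x)
  calc x * Real.sqrt x * Real.exp (-x) ≤ Real.exp (x / 2) * Real.exp (x / 2) * Real.exp (-x) := by
        gcongr
    _ = 1 := by rw [← Real.exp_add, ← Real.exp_add]; norm_num

/-- `x e^{-x} ≤ 1 - e^{-x}` (i.e. `1 + x ≤ eˣ`). [folklore] -/
theorem mul_exp_neg_le_one_sub_exp_neg (x : ℝ) :
    x * Real.exp (-x) ≤ 1 - Real.exp (-x) := by
  have h : (x + 1) * Real.exp (-x) ≤ 1 := by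
    calc (x + 1) * Real.exp (-x) ≤ Real.exp x * Real.exp (-x) :=
          mul_le_mul_of_nonneg_right (Real.add_one_le_exp x) (Real.exp_pos _).le
      _ = 1 := by rw [← Real.exp_add, add_neg_cancel, Real.exp_zero]
  linarith

/-! ## 2. `rpow` bookkeeping -/

/-- `x^{-1/2} = (√x)⁻¹` for `x > 0`. [folklore] -/
theorem rpow_neg_half_eq {x : ℝ} (hx : 0 < x) : x ^ (-(1 / 2 : ℝ)) = (Real.sqrt x)⁻¹ := by
  rw [Real.sqrt_eq_rpow, ← Real.rpow_neg hx.le]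

/-- `x^{-3/2} = x⁻¹ (√x)⁻¹` for `x > 0`. [folklore] -/
theorem rpow_neg_three_half_eq {x : ℝ} (hx : 0 < x) :
    x ^ (-(3 / 2 : ℝ)) = x⁻¹ * (Real.sqrt x)⁻¹ := by
  rw [show (-(3 / 2 : ℝ)) = -1 + -(1 / 2) by norm_num, Real.rpow_add hx, Real.rpow_neg_one,
    rpow_neg_half_eq hx]

/-- `(√x)⁻¹ ≤ x⁻¹ (√x)⁻¹ · x`, i.e. bounds of type `A/√x` are of type `A x · x^{-3/2}`;
concretely `e^{-x}/√x ≤ x^{-3/2}` for `x > 0`. [folklore] -/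
theorem exp_neg_div_sqrt_le {x : ℝ} (hx : 0 < x) :
    Real.exp (-x) * (Real.sqrt x)⁻¹ ≤ x ^ (-(3 / 2 : ℝ)) := by
  rw [rpow_neg_three_half_eq hx]
  have hs : 0 < Real.sqrt x := Real.sqrt_pos.mpr hx
  apply mul_le_mul_of_nonneg_right _ (inv_pos.mpr hs).le
  have h := mul_exp_neg_le_one x
  calc Real.exp (-x) = x⁻¹ * (x * Real.exp (-x)) := by field_simp
    _ ≤ x⁻¹ * 1 := by gcongr
    _ = x⁻¹ := mul_one _

/-- `e^{-x} ≤ x^{-3/2}` for `x > 0`. [folklore] -/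
theorem exp_neg_le_rpow_neg_three_half {x : ℝ} (hx : 0 < x) :
    Real.exp (-x) ≤ x ^ (-(3 / 2 : ℝ)) := by
  rw [rpow_neg_three_half_eq hx, ← mul_inv, le_inv_comm₀ (Real.exp_pos _) (by positivity),
    ← Real.exp_neg, neg_neg]
  have h := mul_sqrt_mul_exp_neg_le_one hx.le
  calc x * Real.sqrt x = x * Real.sqrt x * Real.exp (-x) * Real.exp x := by
        rw [mul_assoc (x * Real.sqrt x), ← Real.exp_add, neg_add_cancel, Real.exp_zero, mul_one]
    _ ≤ 1 * Real.exp x := by gcongr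
    _ = Real.exp x := one_mul _

/-- `e^{-x} ≤ (1/2) x^{-1/2}` for `x > 0`. [folklore] -/
theorem exp_neg_le_half_rpow_neg_half {x : ℝ} (hx : 0 < x) :
    Real.exp (-x) ≤ 1 / 2 * x ^ (-(1 / 2 : ℝ)) := by
  rw [rpow_neg_half_eq hx]
  have hs : 0 < Real.sqrt x := Real.sqrt_pos.mpr hx
  rw [← div_eq_mul_inv, le_div_iff₀ hs, mul_comm]
  exact sqrt_mul_exp_neg_le_half hx.le

/-- `e^{-x/2}/(2√x) ≤ (1/2) x^{-3/2}` for `x > 0` (from `x e^{-x/2} ≤ 1`). [folklore] -/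
theorem exp_neg_half_div_le {x : ℝ} (hx : 0 < x) :
    Real.exp (-(x / 2)) / (2 * Real.sqrt x) ≤ 1 / 2 * x ^ (-(3 / 2 : ℝ)) := by
  rw [rpow_neg_three_half_eq hx]
  have hs : 0 < Real.sqrt x := Real.sqrt_pos.mpr hx
  rw [div_le_iff₀ (by positivity)]
  have e : 1 / 2 * (x⁻¹ * (Real.sqrt x)⁻¹) * (2 * Real.sqrt x) = x⁻¹ := by
    field_simp
  rw [e, le_inv_comm₀ (Real.exp_pos _) hx, ← Real.exp_neg, neg_neg]
  have h := mul_exp_neg_half_le_one hx.le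
  calc x = x * Real.exp (-(x / 2)) * Real.exp (x / 2) := by
        rw [mul_assoc, ← Real.exp_add, neg_add_cancel, Real.exp_zero, mul_one]
    _ ≤ 1 * Real.exp (x / 2) := by gcongr
    _ = Real.exp (x / 2) := one_mul _

/-! ## 3. The profiles `m(x) = √(1 - e^{-x})` and `M = m³` -/

/-- `m(x) = √(1 - e^{-x})` (`= 0` for `x ≤ 0`). [folklore] -/
def mHalf (x : ℝ) : ℝ := Real.sqrt (1 - Real.exp (-x))

/-- `m'(x) = e^{-x} / (2 m(x))` (`x > 0`). [folklore] -/
def mHalfDeriv (x : ℝ) : ℝ := Real.exp (-x) / (2 * mHalf x)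

/-- `m''(x) = -e^{-x}/(2m) - e^{-2x}/(4m³)` (`x > 0`). [folklore] -/
def mHalfDeriv2 (x : ℝ) : ℝ :=
  -(Real.exp (-x) / (2 * mHalf x)) - Real.exp (-x) ^ 2 / (4 * mHalf x ^ 3)

/-- `M(x) = m(x)³ = (1 - e^{-x})_+^{3/2}`. [folklore] -/
def M3 (x : ℝ) : ℝ := mHalf x ^ 3

/-- `M'(x) = (3/2) e^{-x} m(x)`. [folklore] -/
def M3Deriv (x : ℝ) : ℝ := 3 / 2 * Real.exp (-x) * mHalf x

/-- `M''(x) = (3/2) e^{-x} (m'(x) - m(x))` (`x > 0`). [folklore] -/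
def M3Deriv2 (x : ℝ) : ℝ := 3 / 2 * Real.exp (-x) * (mHalfDeriv x - mHalf x)

/-- `M'''(x) = (3/2) e^{-x} (m'' - 2m' + m)` (`x > 0`). [folklore] -/
def M3Deriv3 (x : ℝ) : ℝ := 3 / 2 * Real.exp (-x) * (mHalfDeriv2 x - 2 * mHalfDeriv x + mHalf x)

variable {x : ℝ}

/-- `1 - e^{-x} > 0` for `x > 0`. [folklore] -/
theorem one_sub_exp_neg_pos (hx : 0 < x) : 0 < 1 - Real.exp (-x) := by
  have : Real.exp (-x) < 1 := Real.exp_lt_one_iff.mpr (by linarith)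
  linarith

/-- `m ≥ 0`. [folklore] -/
theorem mHalf_nonneg (x : ℝ) : 0 ≤ mHalf x := Real.sqrt_nonneg _

/-- `m ≤ 1`. [folklore] -/
theorem mHalf_le_one (x : ℝ) : mHalf x ≤ 1 := by
  unfold mHalf
  rw [Real.sqrt_le_one]
  linarith [Real.exp_pos (-x)]

/-- `|m| ≤ 1`. [folklore] -/
theorem abs_mHalf_le_one (x : ℝ) : |mHalf x| ≤ 1 := by
  rw [abs_of_nonneg (mHalf_nonneg x)]; exact mHalf_le_one x

/-- `m(0) = 0`. [folklore] -/
theorem mHalf_zero : mHalf 0 = 0 := by simp [mHalf]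

/-- `m > 0` on `(0, ∞)`. [folklore] -/
theorem mHalf_pos (hx : 0 < x) : 0 < mHalf x := Real.sqrt_pos.mpr (one_sub_exp_neg_pos hx)

/-- `m² = 1 - e^{-x}` for `x ≥ 0`. [folklore] -/
theorem mHalf_sq (hx : 0 ≤ x) : mHalf x ^ 2 = 1 - Real.exp (-x) := by
  unfold mHalf
  rw [Real.sq_sqrt]
  have : Real.exp (-x) ≤ 1 := Real.exp_le_one_iff.mpr (by linarith)
  linarith

/-- `√x e^{-x/2} ≤ m(x)` for `x ≥ 0` (from `x e^{-x} ≤ 1 - e^{-x}`). [folklore] -/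
theorem sqrt_mul_exp_le_mHalf (hx : 0 ≤ x) : Real.sqrt x * Real.exp (-(x / 2)) ≤ mHalf x := by
  have h := mul_exp_neg_le_one_sub_exp_neg x
  have e : Real.sqrt x * Real.exp (-(x / 2)) = Real.sqrt (x * Real.exp (-x)) := by
    rw [Real.sqrt_mul hx, show Real.exp (-x) = Real.exp (-(x / 2)) ^ 2 by
      rw [← Real.exp_nat_mul]; congr 1; push_cast; ring, Real.sqrt_sq (Real.exp_pos _).le]
  rw [e]
  exact Real.sqrt_le_sqrt h

/-- `m` is continuous. [folklore] -/
theorem continuous_mHalf : Continuous mHalf := by unfold mHalf; fun_prop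

/-- `m` is measurable. [folklore] -/
theorem measurable_mHalf : Measurable mHalf := continuous_mHalf.measurable

/-- `m'` is measurable. [folklore] -/
theorem measurable_mHalfDeriv : Measurable mHalfDeriv := by
  unfold mHalfDeriv; exact (by fun_prop : Measurable fun x => Real.exp (-x)).div
    (measurable_const.mul measurable_mHalf)

/-- `m' ≥ 0`. [folklore] -/
theorem mHalfDeriv_nonneg (x : ℝ) : 0 ≤ mHalfDeriv x := by
  unfold mHalfDeriv
  exact div_nonneg (Real.exp_pos _).le (mul_nonneg (by norm_num) (mHalf_nonneg x))

/-- `m'(x) = e^{-x}/(2√(1 - e^{-x}))`: derivative of `m` on `(0, ∞)`. [folklore] -/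
theorem hasDerivAt_mHalf (hx : 0 < x) : HasDerivAt mHalf (mHalfDeriv x) x := by
  have h1 : HasDerivAt (fun x => 1 - Real.exp (-x)) (Real.exp (-x)) x := by
    have := ((hasDerivAt_neg x).exp).const_sub 1
    simpa using this
  have h2 := h1.sqrt (one_sub_exp_neg_pos hx).ne'
  unfold mHalfDeriv mHalf
  exact h2

/-- `m''`: derivative of `m'` on `(0, ∞)`. [folklore] -/
theorem hasDerivAt_mHalfDeriv (hx : 0 < x) : HasDerivAt mHalfDeriv (mHalfDeriv2 x) x := by
  have hm : mHalf x ≠ 0 := (mHalf_pos hx).ne'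
  have hnum : HasDerivAt (fun x => Real.exp (-x)) (-Real.exp (-x)) x := by
    simpa using (hasDerivAt_neg x).exp
  have hden : HasDerivAt (fun x => 2 * mHalf x) (2 * mHalfDeriv x) x :=
    (hasDerivAt_mHalf hx).const_mul 2
  have h := hnum.div hden (by positivity)
  unfold mHalfDeriv at h ⊢
  refine h.congr_deriv ?_
  unfold mHalfDeriv2
  field_simp
  ring

/-- `m'` is continuous on `(0, ∞)`. [folklore] -/
theorem continuousOn_mHalfDeriv : ContinuousOn mHalfDeriv (Ioi 0) := fun _ hx =>
  (hasDerivAt_mHalfDeriv hx).continuousAt.continuousWithinAt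

/-- `m''` is continuous on `(0, ∞)`. [folklore] -/
theorem continuousOn_mHalfDeriv2 : ContinuousOn mHalfDeriv2 (Ioi 0) := by
  have h1 : ContinuousOn (fun x => Real.exp (-x) / (2 * mHalf x)) (Ioi 0) :=
    ContinuousOn.div (by fun_prop) (continuousOn_const.mul continuous_mHalf.continuousOn)
      (fun x hx => by have := mHalf_pos (show 0 < x from hx); positivity)
  have h2 : ContinuousOn (fun x => Real.exp (-x) ^ 2 / (4 * mHalf x ^ 3)) (Ioi 0) :=
    ContinuousOn.div (by fun_prop) (continuousOn_const.mul (continuous_mHalf.pow 3).continuousOn)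
      (fun x hx => by have := mHalf_pos (show 0 < x from hx); positivity)
  exact (h1.neg).sub h2

/-- **`0 ≤ m'(x) ≤ x^{-1/2}/2`** on `(0, ∞)`. [folklore] -/
theorem mHalfDeriv_le (hx : 0 < x) : mHalfDeriv x ≤ 1 / 2 * x ^ (-(1 / 2 : ℝ)) := by
  have hm := mHalf_pos hx
  have hkey := sqrt_mul_exp_le_mHalf hx.le
  have hs : 0 < Real.sqrt x := Real.sqrt_pos.mpr hx
  rw [rpow_neg_half_eq hx]
  unfold mHalfDeriv
  rw [div_le_iff₀ (by positivity)]
  -- `e^{-x} ≤ (1/2) (√x)⁻¹ · 2 m = m/√x`, i.e. `√x e^{-x} ≤ m`; and `√x e^{-x} ≤ √x e^{-x/2} ≤ m`.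
  have h1 : Real.sqrt x * Real.exp (-x) ≤ mHalf x := by
    refine le_trans ?_ hkey
    apply mul_le_mul_of_nonneg_left _ hs.le
    exact Real.exp_le_exp.mpr (by linarith)
  calc Real.exp (-x) = (Real.sqrt x)⁻¹ * (Real.sqrt x * Real.exp (-x)) := by
        rw [← mul_assoc, inv_mul_cancel₀ hs.ne', one_mul]
    _ ≤ (Real.sqrt x)⁻¹ * mHalf x := mul_le_mul_of_nonneg_left h1 (inv_pos.mpr hs).le
    _ = 1 / 2 * (Real.sqrt x)⁻¹ * (2 * mHalf x) := by ring

/-- `|m'(x)| ≤ (1/2) x^{-1/2}` on `(0, ∞)`. [folklore] -/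
theorem abs_mHalfDeriv_le (hx : 0 < x) : |mHalfDeriv x| ≤ 1 / 2 * x ^ (-(1 / 2 : ℝ)) := by
  rw [abs_of_nonneg (mHalfDeriv_nonneg x)]; exact mHalfDeriv_le hx

/-- `e^{-x}/(2m) ≤ e^{-x/2}/(2√x)` on `(0, ∞)`. [folklore] -/
theorem exp_neg_div_two_mHalf_le (hx : 0 < x) :
    Real.exp (-x) / (2 * mHalf x) ≤ Real.exp (-(x / 2)) / (2 * Real.sqrt x) := by
  have hm := mHalf_pos hx
  have hs : 0 < Real.sqrt x := Real.sqrt_pos.mpr hx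
  have hkey := sqrt_mul_exp_le_mHalf hx.le
  rw [div_le_div_iff₀ (by positivity) (by positivity)]
  have e : Real.exp (-x) = Real.exp (-(x / 2)) * Real.exp (-(x / 2)) := by
    rw [← Real.exp_add]; ring_nf
  rw [e]
  calc Real.exp (-(x / 2)) * Real.exp (-(x / 2)) * (2 * Real.sqrt x)
      = Real.exp (-(x / 2)) * 2 * (Real.sqrt x * Real.exp (-(x / 2))) := by ring
    _ ≤ Real.exp (-(x / 2)) * 2 * mHalf x := by gcongr
    _ = Real.exp (-(x / 2)) * (2 * mHalf x) := by ring

/-- **`|m''(x)| ≤ (3/4) x^{-3/2}`** on `(0, ∞)`. [folklore] -/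
theorem abs_mHalfDeriv2_le (hx : 0 < x) : |mHalfDeriv2 x| ≤ 3 / 4 * x ^ (-(3 / 2 : ℝ)) := by
  have hm := mHalf_pos hx
  have hs : 0 < Real.sqrt x := Real.sqrt_pos.mpr hx
  have hkey := sqrt_mul_exp_le_mHalf hx.le
  have h1 : Real.exp (-x) / (2 * mHalf x) ≤ 1 / 2 * x ^ (-(3 / 2 : ℝ)) :=
    (exp_neg_div_two_mHalf_le hx).trans (exp_neg_half_div_le hx)
  -- second piece: `e^{-2x}/(4m³) ≤ e^{-2x} e^{3x/2}/(4 x^{3/2}) = e^{-x/2}/(4 x √x) ≤ 1/(4 x √x)`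
  have hm3 : (Real.sqrt x * Real.exp (-(x / 2))) ^ 3 ≤ mHalf x ^ 3 :=
    pow_le_pow_left₀ (by positivity) hkey 3
  have h2 : Real.exp (-x) ^ 2 / (4 * mHalf x ^ 3) ≤ 1 / 4 * x ^ (-(3 / 2 : ℝ)) := by
    rw [rpow_neg_three_half_eq hx]
    rw [div_le_iff₀ (by positivity)]
    have hx3 : (Real.sqrt x) ^ 3 = x * Real.sqrt x := by
      rw [pow_succ, Real.sq_sqrt hx.le]
    have he3 : Real.exp (-(x / 2)) ^ 3 = Real.exp (-(3 * x / 2)) := by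
      rw [← Real.exp_nat_mul]; ring_nf
    have hprod : (Real.sqrt x * Real.exp (-(x / 2))) ^ 3 = x * Real.sqrt x * Real.exp (-(3 * x / 2)) := by
      rw [mul_pow, hx3, he3]
    rw [hprod] at hm3
    -- want: e^{-2x} ≤ (1/4) x⁻¹ (√x)⁻¹ (4 m³); suffices with m³ ≥ x√x e^{-3x/2}
    have hexp2 : Real.exp (-x) ^ 2 = Real.exp (-(3 * x / 2)) * Real.exp (-(x / 2)) := by
      rw [← Real.exp_nat_mul, ← Real.exp_add]; ring_nf
    have hhalf : Real.exp (-(x / 2)) ≤ 1 := Real.exp_le_one_iff.mpr (by linarith)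
    calc Real.exp (-x) ^ 2 = Real.exp (-(3 * x / 2)) * Real.exp (-(x / 2)) := hexp2
      _ ≤ Real.exp (-(3 * x / 2)) * 1 := by gcongr
      _ = 1 / 4 * (x⁻¹ * (Real.sqrt x)⁻¹) * (4 * (x * Real.sqrt x * Real.exp (-(3 * x / 2)))) := by
          field_simp
      _ ≤ 1 / 4 * (x⁻¹ * (Real.sqrt x)⁻¹) * (4 * mHalf x ^ 3) := by gcongr
  unfold mHalfDeriv2
  have hA : 0 ≤ Real.exp (-x) / (2 * mHalf x) := by positivity
  have hB : 0 ≤ Real.exp (-x) ^ 2 / (4 * mHalf x ^ 3) := by positivity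
  rw [abs_le]
  constructor <;> nlinarith

/-- `M` is continuous. [folklore] -/
theorem continuous_M3 : Continuous M3 := continuous_mHalf.pow 3

/-- `M'` is continuous. [folklore] -/
theorem continuous_M3Deriv : Continuous M3Deriv := by
  unfold M3Deriv
  exact (continuous_const.mul (Real.continuous_exp.comp continuous_neg)).mul continuous_mHalf

/-- `M(0) = 0`. [folklore] -/
theorem M3_zero : M3 0 = 0 := by simp [M3, mHalf_zero]

/-- `M'(0) = 0`. [folklore] -/
theorem M3Deriv_zero : M3Deriv 0 = 0 := by simp [M3Deriv, mHalf_zero]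

/-- `0 ≤ M ≤ 1`. [folklore] -/
theorem M3_nonneg (x : ℝ) : 0 ≤ M3 x := pow_nonneg (mHalf_nonneg x) 3

/-- `M ≤ 1`. [folklore] -/
theorem M3_le_one (x : ℝ) : M3 x ≤ 1 := pow_le_one₀ (mHalf_nonneg x) (mHalf_le_one x)

/-- `|M| ≤ 1`. [folklore] -/
theorem abs_M3_le_one (x : ℝ) : |M3 x| ≤ 1 := by
  rw [abs_of_nonneg (M3_nonneg x)]; exact M3_le_one x

/-- `M' ≥ 0`. [folklore] -/
theorem M3Deriv_nonneg (x : ℝ) : 0 ≤ M3Deriv x := by unfold M3Deriv; positivity [mHalf_nonneg x]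

/-- `M' ≤ 3/2`. [folklore] -/
theorem M3Deriv_le (hx : 0 ≤ x) : M3Deriv x ≤ 3 / 2 := by
  unfold M3Deriv
  have h1 : Real.exp (-x) ≤ 1 := Real.exp_le_one_iff.mpr (by linarith)
  have h2 := mHalf_le_one x
  have h3 := mHalf_nonneg x
  calc 3 / 2 * Real.exp (-x) * mHalf x ≤ 3 / 2 * 1 * 1 := by gcongr
    _ = 3 / 2 := by norm_num

/-- `M' = (3/2) e^{-x} m`: derivative of `M = m³` on `(0, ∞)`. [folklore] -/
theorem hasDerivAt_M3 (hx : 0 < x) : HasDerivAt M3 (M3Deriv x) x := by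
  have h := (hasDerivAt_mHalf hx).pow 3
  unfold M3
  refine h.congr_deriv ?_
  unfold M3Deriv mHalfDeriv
  have hm := (mHalf_pos hx).ne'
  have hsq := mHalf_sq hx.le
  field_simp
  simp only [Nat.cast_ofNat, Nat.add_one_sub_one]
  nlinarith [hsq]

/-- `M''`: derivative of `M'` on `(0, ∞)`. [folklore] -/
theorem hasDerivAt_M3Deriv (hx : 0 < x) : HasDerivAt M3Deriv (M3Deriv2 x) x := by
  have he : HasDerivAt (fun x => 3 / 2 * Real.exp (-x)) (3 / 2 * -Real.exp (-x)) x := by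
    have := ((hasDerivAt_neg x).exp).const_mul (3 / 2)
    simpa using this
  have h := he.mul (hasDerivAt_mHalf hx)
  unfold M3Deriv
  refine h.congr_deriv ?_
  unfold M3Deriv2
  ring

/-- `M'''`: derivative of `M''` on `(0, ∞)`. [folklore] -/
theorem hasDerivAt_M3Deriv2 (hx : 0 < x) : HasDerivAt M3Deriv2 (M3Deriv3 x) x := by
  have he : HasDerivAt (fun x => 3 / 2 * Real.exp (-x)) (3 / 2 * -Real.exp (-x)) x := by
    have := ((hasDerivAt_neg x).exp).const_mul (3 / 2)
    simpa using this
  have hsub : HasDerivAt (fun x => mHalfDeriv x - mHalf x) (mHalfDeriv2 x - mHalfDeriv x) x :=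
    (hasDerivAt_mHalfDeriv hx).sub (hasDerivAt_mHalf hx)
  have h := he.mul hsub
  unfold M3Deriv2
  refine h.congr_deriv ?_
  unfold M3Deriv3
  ring

/-- `M''` is continuous on `(0, ∞)`. [folklore] -/
theorem continuousOn_M3Deriv2 : ContinuousOn M3Deriv2 (Ioi 0) := fun _ hx =>
  (hasDerivAt_M3Deriv2 hx).continuousAt.continuousWithinAt

/-- `M'''` is continuous on `(0, ∞)`. [folklore] -/
theorem continuousOn_M3Deriv3 : ContinuousOn M3Deriv3 (Ioi 0) := by
  unfold M3Deriv3
  refine ContinuousOn.mul (by fun_prop) ?_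
  exact ((continuousOn_mHalfDeriv2.sub (continuousOn_const.mul continuousOn_mHalfDeriv)).add
    continuous_mHalf.continuousOn)

/-- `M''` is measurable. [folklore] -/
theorem measurable_M3Deriv2 : Measurable M3Deriv2 := by
  unfold M3Deriv2
  exact ((by fun_prop : Measurable fun x => 3 / 2 * Real.exp (-x))).mul
    (measurable_mHalfDeriv.sub measurable_mHalf)

/-- **`|M''(x)| ≤ (3/2) x^{-1/2}`** on `(0, ∞)`. [folklore] -/
theorem abs_M3Deriv2_le (hx : 0 < x) : |M3Deriv2 x| ≤ 3 / 2 * x ^ (-(1 / 2 : ℝ)) := by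
  unfold M3Deriv2
  have h1 := mHalfDeriv_le hx
  have h1' := mHalfDeriv_nonneg x
  have h2 := exp_neg_le_half_rpow_neg_half hx
  have h3 := mHalf_le_one x
  have h4 := mHalf_nonneg x
  have he : 0 < Real.exp (-x) := Real.exp_pos _
  have he1 : Real.exp (-x) ≤ 1 := Real.exp_le_one_iff.mpr (by linarith)
  have hr : 0 < x ^ (-(1 / 2 : ℝ)) := Real.rpow_pos_of_pos hx _
  rw [abs_le]
  constructor
  · -- lower bound: `-(3/2) e^{-x} m ≥ -(3/2) e^{-x} ≥ -(3/4) x^{-1/2}`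
    have : 3 / 2 * Real.exp (-x) * (mHalfDeriv x - mHalf x) ≥ -(3 / 2 * Real.exp (-x) * 1) := by
      nlinarith
    nlinarith
  · have : 3 / 2 * Real.exp (-x) * (mHalfDeriv x - mHalf x) ≤ 3 / 2 * (Real.exp (-x) * mHalfDeriv x) := by
      nlinarith
    have h5 : Real.exp (-x) * mHalfDeriv x ≤ 1 * (1 / 2 * x ^ (-(1 / 2 : ℝ))) := by gcongr
    nlinarith

/-- **`|M'''(x)| ≤ (33/8) x^{-3/2}`** on `(0, ∞)`. [folklore] -/
theorem abs_M3Deriv3_le (hx : 0 < x) : |M3Deriv3 x| ≤ 33 / 8 * x ^ (-(3 / 2 : ℝ)) := by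
  unfold M3Deriv3
  have h1 := abs_mHalfDeriv2_le hx
  have h2 := mHalfDeriv_le hx
  have h2' := mHalfDeriv_nonneg x
  have h3 := mHalf_le_one x
  have h4 := mHalf_nonneg x
  have he : 0 < Real.exp (-x) := Real.exp_pos _
  have he1 : Real.exp (-x) ≤ 1 := Real.exp_le_one_iff.mpr (by linarith)
  have hA := exp_neg_le_rpow_neg_three_half hx           -- e^{-x} ≤ x^{-3/2}
  have hB : Real.exp (-x) * x ^ (-(1 / 2 : ℝ)) ≤ x ^ (-(3 / 2 : ℝ)) := by
    rw [rpow_neg_half_eq hx]; exact exp_neg_div_sqrt_le hx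
  have hr : 0 < x ^ (-(3 / 2 : ℝ)) := Real.rpow_pos_of_pos hx _
  rw [abs_mul, abs_of_pos (by positivity : (0:ℝ) < 3 / 2 * Real.exp (-x))]
  have htri : |mHalfDeriv2 x - 2 * mHalfDeriv x + mHalf x| ≤
      |mHalfDeriv2 x| + 2 * mHalfDeriv x + mHalf x := by
    have := abs_add_le (mHalfDeriv2 x - 2 * mHalfDeriv x) (mHalf x)
    have h' := abs_sub (mHalfDeriv2 x) (2 * mHalfDeriv x)
    rw [abs_of_nonneg (by positivity : (0:ℝ) ≤ 2 * mHalfDeriv x)] at h'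
    rw [abs_of_nonneg h4] at this
    linarith
  calc 3 / 2 * Real.exp (-x) * |mHalfDeriv2 x - 2 * mHalfDeriv x + mHalf x|
      ≤ 3 / 2 * Real.exp (-x) * (|mHalfDeriv2 x| + 2 * mHalfDeriv x + mHalf x) := by gcongr
    _ = 3 / 2 * (Real.exp (-x) * |mHalfDeriv2 x| + 2 * (Real.exp (-x) * mHalfDeriv x) +
          Real.exp (-x) * mHalf x) := by ring
    _ ≤ 3 / 2 * (1 * (3 / 4 * x ^ (-(3 / 2 : ℝ))) + 2 * (Real.exp (-x) * (1 / 2 * x ^ (-(1 / 2 : ℝ)))) +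
          Real.exp (-x) * 1) := by gcongr
    _ = 3 / 2 * (3 / 4 * x ^ (-(3 / 2 : ℝ)) + Real.exp (-x) * x ^ (-(1 / 2 : ℝ)) + Real.exp (-x)) := by ring
    _ ≤ 3 / 2 * (3 / 4 * x ^ (-(3 / 2 : ℝ)) + x ^ (-(3 / 2 : ℝ)) + x ^ (-(3 / 2 : ℝ))) := by gcongr
    _ = 33 / 8 * x ^ (-(3 / 2 : ℝ)) := by ring


/-! ## 4. The core oscillatory lemma: an inverse-square-root endpoint costs `|t|^{-1/2}` -/

/-- `‖e^{ixt}‖ = 1` for real `x`, `t`. [folklore] -/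
theorem norm_cexp_I_mul_real (x t : ℝ) : ‖Complex.exp (Complex.I * x * t)‖ = 1 := by
  rw [show Complex.I * x * t = ((x * t : ℝ) : ℂ) * Complex.I by push_cast; ring]
  exact Complex.norm_exp_ofReal_mul_I _

/-- `∫_0^c x^{-1/2} dx = 2 c^{1/2}`. [folklore] -/
theorem integral_rpow_neg_half (c : ℝ) :
    ∫ x in (0 : ℝ)..c, x ^ (-(1 / 2 : ℝ)) = 2 * c ^ (1 / 2 : ℝ) := by
  rw [integral_rpow (Or.inl (by norm_num)), show (-(1 / 2 : ℝ)) + 1 = 1 / 2 by norm_num,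
    Real.zero_rpow (by norm_num)]
  ring

/-- `∫_δ^L x^{-3/2} dx ≤ 2 δ^{-1/2}` for `0 < δ ≤ L`. [folklore] -/
theorem integral_rpow_neg_three_half_le {δ L : ℝ} (hδ : 0 < δ) (hδL : δ ≤ L) :
    ∫ x in δ..L, x ^ (-(3 / 2 : ℝ)) ≤ 2 * δ ^ (-(1 / 2 : ℝ)) := by
  have h0 : (0 : ℝ) ∉ uIcc δ L := by
    rw [uIcc_of_le hδL]; intro h; exact absurd h.1 (not_le.mpr hδ)
  rw [integral_rpow (Or.inr ⟨by norm_num, h0⟩), show (-(3 / 2 : ℝ)) + 1 = -(1 / 2) by norm_num]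
  have hL : 0 ≤ L ^ (-(1 / 2 : ℝ)) := Real.rpow_nonneg (by linarith) _
  have : (L ^ (-(1 / 2 : ℝ)) - δ ^ (-(1 / 2 : ℝ))) / (-(1 / 2 : ℝ)) =
      2 * δ ^ (-(1 / 2 : ℝ)) - 2 * L ^ (-(1 / 2 : ℝ)) := by ring
  rw [this]
  linarith

/-- **The core oscillatory lemma.** Let `φ` be `C¹` on `(0, ∞)` with `|φ(x)| ≤ A x^{-1/2}` and
`|φ'(x)| ≤ A' x^{-3/2}`, and let `ψ` be continuous on `[0, L]`, differentiable inside with an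
integrable derivative, `|ψ| ≤ B` and `∫_0^L |ψ'| ≤ V`. Then for real `|t| ≥ 1`,
`|∫_0^L e^{ixt} φ(x) ψ(x) dx| ≤ (4AB + 2A'B + AV) |t|^{-1/2}`, uniformly in `L > 0`
(split at `δ = 1/|t|`: trivially on `[0, δ]`, by parts on `[δ, L]`). [folklore] -/
theorem norm_integral_cexp_mul_singular_le {φ φ' ψ ψ' : ℝ → ℝ} {A A' B V L t : ℝ}
    (hL : 0 < L) (ht : 1 ≤ |t|)
    (hφd : ∀ x, 0 < x → HasDerivAt φ (φ' x) x) (hφ'c : ContinuousOn φ' (Ioi 0))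
    (hφb : ∀ x, 0 < x → |φ x| ≤ A * x ^ (-(1 / 2 : ℝ)))
    (hφ'b : ∀ x, 0 < x → |φ' x| ≤ A' * x ^ (-(3 / 2 : ℝ)))
    (hψc : ContinuousOn ψ (Icc 0 L)) (hψd : ∀ x ∈ Ioo 0 L, HasDerivAt ψ (ψ' x) x)
    (hψb : ∀ x ∈ Icc 0 L, |ψ x| ≤ B) (hψ'i : IntervalIntegrable ψ' volume 0 L)
    (hV : ∫ x in (0 : ℝ)..L, |ψ' x| ≤ V) :
    ‖∫ x in (0 : ℝ)..L, Complex.exp (Complex.I * x * t) * ((φ x * ψ x : ℝ) : ℂ)‖ ≤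
      (4 * A * B + 2 * A' * B + A * V) * |t| ^ (-(1 / 2 : ℝ)) := by
  -- signs of the constants
  have hA : 0 ≤ A := by
    have h := hφb 1 one_pos
    rw [Real.one_rpow, mul_one] at h
    exact (abs_nonneg _).trans h
  have hA' : 0 ≤ A' := by
    have h := hφ'b 1 one_pos
    rw [Real.one_rpow, mul_one] at h
    exact (abs_nonneg _).trans h
  have hB : 0 ≤ B := (abs_nonneg _).trans (hψb 0 ⟨le_rfl, hL.le⟩)
  have hV0 : 0 ≤ V :=
    le_trans (intervalIntegral.integral_nonneg hL.le (fun x _ => abs_nonneg _)) hV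
  have ht0 : 0 < |t| := lt_of_lt_of_le one_pos ht
  set δ : ℝ := |t|⁻¹ with hδ
  have hδ0 : 0 < δ := inv_pos.mpr ht0
  have hδ1 : δ ≤ 1 := inv_le_one_of_one_le₀ ht
  have hδhalf : δ ^ (1 / 2 : ℝ) = |t| ^ (-(1 / 2 : ℝ)) := by rw [hδ, rpow_half_inv_eq ht0]
  have hδnegHalf : δ ^ (-(1 / 2 : ℝ)) / |t| = |t| ^ (-(1 / 2 : ℝ)) := by
    rw [hδ, rpow_neg_half_inv_eq ht0, div_eq_mul_inv, rpow_half_mul_inv_eq ht0]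
  have htpow : 0 < |t| ^ (-(1 / 2 : ℝ)) := Real.rpow_pos_of_pos ht0 _
  -- continuity of `φ`
  have hφc : ContinuousOn φ (Ioi 0) := fun x hx => (hφd x hx).continuousAt.continuousWithinAt
  -- the integrand
  set g : ℝ → ℂ := fun x => ((φ x * ψ x : ℝ) : ℂ) with hg
  have hgc : ∀ {a b : ℝ}, 0 < a → b ≤ L → ContinuousOn g (Icc a b) := by
    intro a b ha hb
    apply Complex.continuous_ofReal.comp_continuousOn
    exact (hφc.mono fun x hx => lt_of_lt_of_le ha hx.1).mul
      (hψc.mono fun x hx => ⟨ha.le.trans hx.1, hx.2.trans hb⟩)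
  have hgnorm : ∀ x ∈ Ioc 0 L, ‖g x‖ ≤ A * B * x ^ (-(1 / 2 : ℝ)) := by
    intro x hx
    rw [hg]
    simp only [Complex.norm_real, Real.norm_eq_abs, abs_mul]
    have h1 := hφb x hx.1
    have h2 := hψb x ⟨hx.1.le, hx.2⟩
    have hr : 0 ≤ x ^ (-(1 / 2 : ℝ)) := Real.rpow_nonneg hx.1.le _
    calc |φ x| * |ψ x| ≤ A * x ^ (-(1 / 2 : ℝ)) * B :=
          mul_le_mul h1 h2 (abs_nonneg _) (mul_nonneg hA hr)
      _ = A * B * x ^ (-(1 / 2 : ℝ)) := by ring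
  -- integrability of `g` on `[0, c]`, `c ≤ L`, by domination (measurability via `Ioo`)
  have hgI : ∀ {c : ℝ}, 0 ≤ c → c ≤ L → IntervalIntegrable g volume 0 c := by
    intro c hc0 hcL
    have hdom : IntervalIntegrable (fun x : ℝ => A * B * x ^ (-(1 / 2 : ℝ))) volume 0 c :=
      (intervalIntegral.intervalIntegrable_rpow' (by norm_num)).const_mul _
    refine hdom.mono_fun' ?_ ?_
    · -- `g` is continuous on `Ioo 0 c`, which is a.e. `Ioc 0 c`
      have hco : ContinuousOn g (Ioo 0 c) := by
        rcases le_or_gt c 0 with hc | hc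
        · rw [Ioo_eq_empty (by simp [hc])]; exact continuousOn_empty _
        · intro x hx
          have hxa : 0 < x / 2 := by linarith [hx.1]
          exact ((hgc hxa hcL) x ⟨by linarith [hx.1], hx.2.le⟩).mono_of_mem_nhdsWithin
            (mem_nhdsWithin_of_mem_nhds (Icc_mem_nhds (by linarith [hx.1]) hx.2))
      have h1 : AEStronglyMeasurable g (volume.restrict (Ioo 0 c)) :=
        hco.aestronglyMeasurable measurableSet_Ioo
      rw [uIoc_of_le hc0, ← Measure.restrict_congr_set Ioo_ae_eq_Ioc]
      exact h1
    · rw [EventuallyLE, ae_restrict_iff' measurableSet_uIoc]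
      refine ae_of_all _ (fun x hx => ?_)
      rw [uIoc_of_le hc0] at hx
      exact hgnorm x ⟨hx.1, hx.2.trans hcL⟩
  have hfI : ∀ {c : ℝ}, 0 ≤ c → c ≤ L →
      IntervalIntegrable (fun x => Complex.exp (Complex.I * x * t) * g x) volume 0 c :=
    fun hc0 hcL => (hgI hc0 hcL).continuousOn_mul (continuous_cexp_mul (t : ℂ)).continuousOn
  -- the near-endpoint estimate on `[0, c]`, `c ≤ δ`
  have hnear : ∀ {c : ℝ}, 0 ≤ c → c ≤ L → c ≤ δ →
      ‖∫ x in (0 : ℝ)..c, Complex.exp (Complex.I * x * t) * g x‖ ≤ 2 * A * B * |t| ^ (-(1 / 2 : ℝ)) := by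
    intro c hc0 hcL hcδ
    have hdom : IntervalIntegrable (fun x : ℝ => A * B * x ^ (-(1 / 2 : ℝ))) volume 0 c :=
      (intervalIntegral.intervalIntegrable_rpow' (by norm_num)).const_mul _
    have h1 : ‖∫ x in (0 : ℝ)..c, Complex.exp (Complex.I * x * t) * g x‖ ≤
        ∫ x in (0 : ℝ)..c, A * B * x ^ (-(1 / 2 : ℝ)) := by
      apply intervalIntegral.norm_integral_le_of_norm_le hc0 _ hdom
      refine ae_of_all _ (fun x hx => ?_)
      rw [norm_mul, norm_cexp_I_mul_real, one_mul]
      exact hgnorm x ⟨hx.1, hx.2.trans hcL⟩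
    refine h1.trans ?_
    rw [intervalIntegral.integral_const_mul, integral_rpow_neg_half c, ← hδhalf]
    have : c ^ (1 / 2 : ℝ) ≤ δ ^ (1 / 2 : ℝ) := Real.rpow_le_rpow hc0 hcδ (by norm_num)
    have hAB : 0 ≤ A * B := mul_nonneg hA hB
    nlinarith
  have hRHS : 2 * A * B * |t| ^ (-(1 / 2 : ℝ)) ≤ (4 * A * B + 2 * A' * B + A * V) * |t| ^ (-(1 / 2 : ℝ)) := by
    apply mul_le_mul_of_nonneg_right _ htpow.le
    nlinarith [mul_nonneg hA hB, mul_nonneg hA' hB, mul_nonneg hA hV0]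
  rcases le_or_gt L δ with hLδ | hδL
  · -- Case `L ≤ δ`: only the near-endpoint estimate
    exact (hnear hL.le le_rfl hLδ).trans hRHS
  -- Case `δ < L`: split at `δ`
  rw [← intervalIntegral.integral_add_adjacent_intervals (hfI hδ0.le hδL.le)
    ((hfI hL.le le_rfl).mono_set (by
      rw [uIcc_of_le hδL.le, uIcc_of_le hL.le]; exact Icc_subset_Icc hδ0.le le_rfl))]
  have h1 := hnear hδ0.le hδL.le le_rfl
  -- the far piece `[δ, L]` by parts
  set g' : ℝ → ℂ := fun x => ((φ' x * ψ x + φ x * ψ' x : ℝ) : ℂ) with hg'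
  have hIccδ : Icc δ L ⊆ Ioi 0 := fun x hx => lt_of_lt_of_le hδ0 hx.1
  have hv : ContinuousOn g (Icc δ L) := hgc hδ0 le_rfl
  have hvv' : ∀ x ∈ Ioo δ L, HasDerivAt g (g' x) x := by
    intro x hx
    have hx0 : 0 < x := lt_trans hδ0 hx.1
    have := ((hφd x hx0).mul (hψd x ⟨hx0, hx.2⟩)).ofReal_comp
    simpa [hg, hg'] using this
  have hr1 : IntervalIntegrable (fun x => φ' x * ψ x) volume δ L := by
    apply ContinuousOn.intervalIntegrable
    rw [uIcc_of_le hδL.le]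
    exact (hφ'c.mono hIccδ).mul (hψc.mono (Icc_subset_Icc hδ0.le le_rfl))
  have hψ'δ : IntervalIntegrable ψ' volume δ L :=
    hψ'i.mono_set (by rw [uIcc_of_le hδL.le, uIcc_of_le hL.le]; exact Icc_subset_Icc hδ0.le le_rfl)
  have hr2 : IntervalIntegrable (fun x => φ x * ψ' x) volume δ L :=
    hψ'δ.continuousOn_mul (by rw [uIcc_of_le hδL.le]; exact hφc.mono hIccδ)
  have hv' : IntervalIntegrable g' volume δ L := by
    have := intervalIntegrable_ofReal (hr1.add hr2)
    simpa [hg'] using this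
  have step := integral_cexp_mul_eq hδL.le (t : ℂ) hv hvv' hv'
  -- bounds for the three terms
  have hgL : ‖g L‖ ≤ A * B * δ ^ (-(1 / 2 : ℝ)) := by
    refine (hgnorm L ⟨hL, le_rfl⟩).trans ?_
    apply mul_le_mul_of_nonneg_left _ (mul_nonneg hA hB)
    exact Real.rpow_le_rpow_of_nonpos hδ0 hδL.le (by norm_num)
  have hgδ : ‖g δ‖ ≤ A * B * δ ^ (-(1 / 2 : ℝ)) := hgnorm δ ⟨hδ0, hδL.le⟩
  have hint : ‖∫ x in δ..L, Complex.exp (Complex.I * x * t) * g' x‖ ≤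
      2 * A' * B * δ ^ (-(1 / 2 : ℝ)) + A * δ ^ (-(1 / 2 : ℝ)) * V := by
    have h0 : (0 : ℝ) ∉ uIcc δ L := by
      rw [uIcc_of_le hδL.le]; intro h; exact absurd h.1 (not_le.mpr hδ0)
    have hbI : IntervalIntegrable
        (fun x : ℝ => A' * B * x ^ (-(3 / 2 : ℝ)) + A * δ ^ (-(1 / 2 : ℝ)) * |ψ' x|) volume δ L :=
      ((intervalIntegral.intervalIntegrable_rpow (Or.inr h0)).const_mul _).add
        (hψ'δ.abs.const_mul _)
    have hle : ‖∫ x in δ..L, Complex.exp (Complex.I * x * t) * g' x‖ ≤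
        ∫ x in δ..L, (A' * B * x ^ (-(3 / 2 : ℝ)) + A * δ ^ (-(1 / 2 : ℝ)) * |ψ' x|) := by
      apply intervalIntegral.norm_integral_le_of_norm_le hδL.le _ hbI
      refine ae_of_all _ (fun x hx => ?_)
      have hx0 : 0 < x := lt_trans hδ0 hx.1
      rw [norm_mul, norm_cexp_I_mul_real, one_mul, hg']
      simp only [Complex.norm_real, Real.norm_eq_abs]
      have e1 := hφ'b x hx0
      have e2 := hψb x ⟨hx0.le, hx.2⟩
      have e3 := hφb x hx0
      have e4 : x ^ (-(1 / 2 : ℝ)) ≤ δ ^ (-(1 / 2 : ℝ)) :=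
        Real.rpow_le_rpow_of_nonpos hδ0 hx.1.le (by norm_num)
      have hr3 : 0 ≤ x ^ (-(3 / 2 : ℝ)) := Real.rpow_nonneg hx0.le _
      have hr1' : 0 ≤ x ^ (-(1 / 2 : ℝ)) := Real.rpow_nonneg hx0.le _
      calc |φ' x * ψ x + φ x * ψ' x| ≤ |φ' x| * |ψ x| + |φ x| * |ψ' x| := by
            refine (abs_add_le _ _).trans ?_; rw [abs_mul, abs_mul]
        _ ≤ A' * x ^ (-(3 / 2 : ℝ)) * B + A * x ^ (-(1 / 2 : ℝ)) * |ψ' x| := by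
            gcongr
        _ ≤ A' * x ^ (-(3 / 2 : ℝ)) * B + A * δ ^ (-(1 / 2 : ℝ)) * |ψ' x| := by gcongr
        _ = A' * B * x ^ (-(3 / 2 : ℝ)) + A * δ ^ (-(1 / 2 : ℝ)) * |ψ' x| := by ring
    refine hle.trans ?_
    rw [intervalIntegral.integral_add ((intervalIntegral.intervalIntegrable_rpow (Or.inr h0)).const_mul _)
      (hψ'δ.abs.const_mul _), intervalIntegral.integral_const_mul, intervalIntegral.integral_const_mul]
    have i1 := integral_rpow_neg_three_half_le hδ0 hδL.le
    have i2 : ∫ x in δ..L, |ψ' x| ≤ V := by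
      refine le_trans ?_ hV
      apply intervalIntegral.integral_mono_interval hδ0.le hδL.le le_rfl
      · exact ae_of_all _ (fun x => abs_nonneg _)
      · exact hψ'i.abs
    have hδp : 0 ≤ δ ^ (-(1 / 2 : ℝ)) := Real.rpow_nonneg hδ0.le _
    nlinarith [mul_nonneg hA' hB, mul_nonneg hA hδp]
  have h2 : ‖∫ x in δ..L, Complex.exp (Complex.I * x * t) * g x‖ ≤
      (2 * A * B + 2 * A' * B + A * V) * |t| ^ (-(1 / 2 : ℝ)) := by
    have e : ‖∫ x in δ..L, Complex.exp (Complex.I * x * t) * g x‖ * |t| =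
        ‖Complex.I * (t : ℂ) * ∫ x in δ..L, Complex.exp (Complex.I * x * t) * g x‖ := by
      rw [norm_mul, norm_mul, Complex.norm_I, one_mul, Complex.norm_real, Real.norm_eq_abs, mul_comm]
    rw [← hδnegHalf, mul_div_assoc', le_div_iff₀ ht0, e, step]
    calc ‖Complex.exp (Complex.I * L * t) * g L - Complex.exp (Complex.I * δ * t) * g δ -
          ∫ x in δ..L, Complex.exp (Complex.I * x * t) * g' x‖
        ≤ ‖Complex.exp (Complex.I * L * t) * g L‖ + ‖Complex.exp (Complex.I * δ * t) * g δ‖ +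
          ‖∫ x in δ..L, Complex.exp (Complex.I * x * t) * g' x‖ := by
            refine (norm_sub_le _ _).trans ?_
            gcongr
            exact norm_sub_le _ _
      _ ≤ A * B * δ ^ (-(1 / 2 : ℝ)) + A * B * δ ^ (-(1 / 2 : ℝ)) +
          (2 * A' * B * δ ^ (-(1 / 2 : ℝ)) + A * δ ^ (-(1 / 2 : ℝ)) * V) := by
            rw [norm_mul, norm_cexp_I_mul_real, one_mul, norm_mul, norm_cexp_I_mul_real, one_mul]
            exact add_le_add (add_le_add hgL hgδ) hint
      _ = (2 * A * B + 2 * A' * B + A * V) * δ ^ (-(1 / 2 : ℝ)) := by ring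
  calc _ ≤ ‖∫ x in (0 : ℝ)..δ, Complex.exp (Complex.I * x * t) * g x‖ +
        ‖∫ x in δ..L, Complex.exp (Complex.I * x * t) * g x‖ := norm_add_le _ _
    _ ≤ 2 * A * B * |t| ^ (-(1 / 2 : ℝ)) + (2 * A * B + 2 * A' * B + A * V) * |t| ^ (-(1 / 2 : ℝ)) :=
        add_le_add h1 h2
    _ = (4 * A * B + 2 * A' * B + A * V) * |t| ^ (-(1 / 2 : ℝ)) := by ring


/-! ## 5. The half-order profile `p_L(x) = m(x) m(L - x)`: one integration by parts -/

variable {L t : ℝ}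

/-- `p_L(x) = m(x) m(L - x)` (the profile of `(cosh R - cosh r)^{1/2}` in the variable `x = r + R`,
`L = 2R`, up to the factor `(e^R/2)^{1/2}`). [folklore] -/
def pHalf (L x : ℝ) : ℝ := mHalf x * mHalf (L - x)

/-- `|p_L| ≤ 1`. [folklore] -/
theorem abs_pHalf_le_one (L x : ℝ) : |pHalf L x| ≤ 1 := by
  rw [pHalf, abs_mul]
  exact mul_le_one₀ (abs_mHalf_le_one x) (abs_nonneg _) (abs_mHalf_le_one _)

/-- `m'` is integrable on `[0, c]` (inverse-square-root singularity at `0`). [folklore] -/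
theorem intervalIntegrable_mHalfDeriv {c : ℝ} (hc : 0 ≤ c) : IntervalIntegrable mHalfDeriv volume 0 c := by
  have hdom : IntervalIntegrable (fun x : ℝ => 1 / 2 * x ^ (-(1 / 2 : ℝ))) volume 0 c :=
    (intervalIntegral.intervalIntegrable_rpow' (by norm_num)).const_mul _
  refine hdom.mono_fun' measurable_mHalfDeriv.aestronglyMeasurable ?_
  rw [EventuallyLE, ae_restrict_iff' measurableSet_uIoc]
  refine ae_of_all _ (fun x hx => ?_)
  rw [uIoc_of_le hc] at hx
  rw [Real.norm_eq_abs]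
  exact abs_mHalfDeriv_le hx.1

/-- `∫_0^L m' = m(L)`. [folklore] -/
theorem integral_mHalfDeriv (hL : 0 ≤ L) : ∫ x in (0 : ℝ)..L, mHalfDeriv x = mHalf L := by
  rw [intervalIntegral.integral_eq_sub_of_hasDerivAt_of_le hL continuous_mHalf.continuousOn
    (fun x hx => hasDerivAt_mHalf hx.1) (intervalIntegrable_mHalfDeriv hL), mHalf_zero, sub_zero]

/-- `x ↦ m(L - x)` has derivative `-m'(L - x)` for `x < L`. [folklore] -/
theorem hasDerivAt_mHalf_sub {x : ℝ} (hx : x < L) :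
    HasDerivAt (fun x => mHalf (L - x)) (-mHalfDeriv (L - x)) x := by
  have h2 : HasDerivAt (fun x => L - x) (-1) x := by simpa using (hasDerivAt_id x).const_sub L
  have := (hasDerivAt_mHalf (by linarith : 0 < L - x)).comp x h2
  refine this.congr_deriv (by ring)

/-- `x ↦ m'(L - x)` is integrable on `[0, L]`. [folklore] -/
theorem intervalIntegrable_mHalfDeriv_sub (hL : 0 ≤ L) :
    IntervalIntegrable (fun x => mHalfDeriv (L - x)) volume 0 L := by
  have := (intervalIntegrable_mHalfDeriv hL).comp_sub_left L
  simp only [sub_zero, sub_self] at this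
  exact this.symm

/-- The first half of `p_L'`: `‖∫_0^L e^{ixt} m'(x) m(L - x) dx‖ ≤ 4 |t|^{-1/2}` (core lemma with
`A = 1/2`, `A' = 3/4`, `B = V = 1`). [folklore] -/
theorem norm_integral_cexp_mHalfDeriv_mul_le (hL : 0 < L) (ht : 1 ≤ |t|) :
    ‖∫ x in (0 : ℝ)..L, Complex.exp (Complex.I * x * t) * ((mHalfDeriv x * mHalf (L - x) : ℝ) : ℂ)‖ ≤
      4 * |t| ^ (-(1 / 2 : ℝ)) := by
  have hV : ∫ x in (0 : ℝ)..L, |(-mHalfDeriv (L - x))| ≤ 1 := by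
    have e : ∫ x in (0 : ℝ)..L, |(-mHalfDeriv (L - x))| = ∫ x in (0 : ℝ)..L, mHalfDeriv (L - x) := by
      refine intervalIntegral.integral_congr (fun x _ => ?_)
      simp only [abs_neg, abs_of_nonneg (mHalfDeriv_nonneg _)]
    rw [e, intervalIntegral.integral_comp_sub_left (fun x => mHalfDeriv x) L, sub_self, sub_zero,
      integral_mHalfDeriv hL.le]
    exact mHalf_le_one L
  have key := norm_integral_cexp_mul_singular_le (φ := mHalfDeriv) (φ' := mHalfDeriv2)
    (ψ := fun x => mHalf (L - x)) (ψ' := fun x => -mHalfDeriv (L - x))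
    (A := 1 / 2) (A' := 3 / 4) (B := 1) (V := 1) hL ht
    (fun x hx => hasDerivAt_mHalfDeriv hx) continuousOn_mHalfDeriv2
    (fun x hx => abs_mHalfDeriv_le hx) (fun x hx => abs_mHalfDeriv2_le hx)
    ((continuous_mHalf.comp (continuous_const.sub continuous_id)).continuousOn)
    (fun x hx => hasDerivAt_mHalf_sub hx.2) (fun x _ => abs_mHalf_le_one _)
    (intervalIntegrable_mHalfDeriv_sub hL.le).neg hV
  refine key.trans (le_of_eq ?_)
  norm_num

/-- The mirror half: `‖∫_0^L e^{ixt} m(x) m'(L - x) dx‖ ≤ 4 |t|^{-1/2}` (substitute `x ↦ L - x`). [folklore] -/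
theorem norm_integral_cexp_mHalf_mul_mHalfDeriv_le (hL : 0 < L) (ht : 1 ≤ |t|) :
    ‖∫ x in (0 : ℝ)..L, Complex.exp (Complex.I * x * t) * ((mHalf x * mHalfDeriv (L - x) : ℝ) : ℂ)‖ ≤
      4 * |t| ^ (-(1 / 2 : ℝ)) := by
  set G : ℝ → ℂ := fun y => Complex.exp (Complex.I * L * t) *
    (Complex.exp (Complex.I * y * (-t : ℝ)) * ((mHalfDeriv y * mHalf (L - y) : ℝ) : ℂ)) with hG
  have h1 : ∫ x in (0 : ℝ)..L, Complex.exp (Complex.I * x * t) * ((mHalf x * mHalfDeriv (L - x) : ℝ) : ℂ) =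
      ∫ x in (0 : ℝ)..L, G (L - x) := by
    refine intervalIntegral.integral_congr (fun x _ => ?_)
    simp only [hG, sub_sub_cancel]
    rw [mul_comm (mHalfDeriv (L - x)), ← mul_assoc, ← Complex.exp_add]
    congr 2
    push_cast
    ring
  have h2 : ∫ x in (0 : ℝ)..L, G (L - x) = ∫ x in (0 : ℝ)..L, G x := by
    rw [intervalIntegral.integral_comp_sub_left G L, sub_self, sub_zero]
  rw [h1, h2, hG, intervalIntegral.integral_const_mul, norm_mul, norm_cexp_I_mul_real, one_mul]
  have ht' : 1 ≤ |(-t)| := by rwa [abs_neg]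
  have := norm_integral_cexp_mHalfDeriv_mul_le hL ht'
  rwa [abs_neg] at this

/-- **The half-order oscillatory bound**: `‖∫_0^L e^{ixt} m(x) m(L - x) dx‖ ≤ 8 |t|^{-3/2}` for
real `|t| ≥ 1`, uniformly in `L ≥ 0` (one integration by parts, no boundary terms since
`m(0) = 0`). [folklore] -/
theorem norm_integral_cexp_pHalf_le (hL : 0 ≤ L) (ht : 1 ≤ |t|) :
    ‖∫ x in (0 : ℝ)..L, Complex.exp (Complex.I * x * t) * (pHalf L x : ℂ)‖ ≤
      8 * |t| ^ (-(3 / 2 : ℝ)) := by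
  have ht0 : 0 < |t| := lt_of_lt_of_le one_pos ht
  rcases hL.eq_or_lt with hL0 | hLpos
  · rw [← hL0, intervalIntegral.integral_same, norm_zero]; positivity
  -- integration by parts
  set v : ℝ → ℂ := fun x => (pHalf L x : ℂ) with hv
  set v' : ℝ → ℂ := fun x =>
    ((mHalfDeriv x * mHalf (L - x) - mHalf x * mHalfDeriv (L - x) : ℝ) : ℂ) with hv'
  have hvc : ContinuousOn v (Icc 0 L) := by
    apply Continuous.continuousOn
    rw [hv]; unfold pHalf
    exact Complex.continuous_ofReal.comp
      (continuous_mHalf.mul (continuous_mHalf.comp (continuous_const.sub continuous_id)))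
  have hvv' : ∀ x ∈ Ioo 0 L, HasDerivAt v (v' x) x := by
    intro x hx
    have hreal : HasDerivAt (pHalf L) (mHalfDeriv x * mHalf (L - x) - mHalf x * mHalfDeriv (L - x)) x := by
      have := (hasDerivAt_mHalf hx.1).mul (hasDerivAt_mHalf_sub hx.2)
      have h2 : pHalf L = (mHalf * fun x => mHalf (L - x)) := funext fun y => rfl
      rw [h2]
      exact this.congr_deriv (by ring)
    rw [hv, hv']
    exact hreal.ofReal_comp
  have hI1 : IntervalIntegrable (fun x => mHalfDeriv x * mHalf (L - x)) volume 0 L :=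
    (intervalIntegrable_mHalfDeriv hL).mul_continuousOn
      ((continuous_mHalf.comp (continuous_const.sub continuous_id)).continuousOn)
  have hI2 : IntervalIntegrable (fun x => mHalf x * mHalfDeriv (L - x)) volume 0 L :=
    (intervalIntegrable_mHalfDeriv_sub hL).continuousOn_mul continuous_mHalf.continuousOn
  have hv'i : IntervalIntegrable v' volume 0 L := by
    have := intervalIntegrable_ofReal (hI1.sub hI2)
    rw [hv']
    refine this.congr (fun x _ => ?_)
    push_cast
    ring
  have step := integral_cexp_mul_eq hL (t : ℂ) hvc hvv' hv'i
  have hb0 : v 0 = 0 := by simp [hv, pHalf, mHalf_zero]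
  have hbL : v L = 0 := by simp [hv, pHalf, mHalf_zero]
  rw [hb0, hbL, mul_zero, mul_zero, sub_zero, zero_sub] at step
  -- the two halves
  have e1 : IntervalIntegrable (fun x => Complex.exp (Complex.I * x * t) *
      ((mHalfDeriv x * mHalf (L - x) : ℝ) : ℂ)) volume 0 L :=
    (intervalIntegrable_ofReal hI1).continuousOn_mul (continuous_cexp_mul (t : ℂ)).continuousOn
  have e2 : IntervalIntegrable (fun x => Complex.exp (Complex.I * x * t) *
      ((mHalf x * mHalfDeriv (L - x) : ℝ) : ℂ)) volume 0 L :=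
    (intervalIntegrable_ofReal hI2).continuousOn_mul (continuous_cexp_mul (t : ℂ)).continuousOn
  have hsplit : ∫ x in (0 : ℝ)..L, Complex.exp (Complex.I * x * t) * v' x =
      (∫ x in (0 : ℝ)..L, Complex.exp (Complex.I * x * t) * ((mHalfDeriv x * mHalf (L - x) : ℝ) : ℂ)) -
        ∫ x in (0 : ℝ)..L, Complex.exp (Complex.I * x * t) * ((mHalf x * mHalfDeriv (L - x) : ℝ) : ℂ) := by
    rw [← intervalIntegral.integral_sub e1 e2]
    refine intervalIntegral.integral_congr (fun x _ => ?_)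
    simp only [hv']
    push_cast
    ring
  have hbound : ‖∫ x in (0 : ℝ)..L, Complex.exp (Complex.I * x * t) * v' x‖ ≤ 8 * |t| ^ (-(1 / 2 : ℝ)) := by
    rw [hsplit]
    calc _ ≤ _ := norm_sub_le _ _
      _ ≤ 4 * |t| ^ (-(1 / 2 : ℝ)) + 4 * |t| ^ (-(1 / 2 : ℝ)) :=
          add_le_add (norm_integral_cexp_mHalfDeriv_mul_le hLpos ht)
            (norm_integral_cexp_mHalf_mul_mHalfDeriv_le hLpos ht)
      _ = 8 * |t| ^ (-(1 / 2 : ℝ)) := by ring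
  -- divide by `|t|`
  have e : ‖∫ x in (0 : ℝ)..L, Complex.exp (Complex.I * x * t) * v x‖ * |t| =
      ‖Complex.I * (t : ℂ) * ∫ x in (0 : ℝ)..L, Complex.exp (Complex.I * x * t) * v x‖ := by
    rw [norm_mul, norm_mul, Complex.norm_I, one_mul, Complex.norm_real, Real.norm_eq_abs, mul_comm]
  have hpow : 8 * |t| ^ (-(3 / 2 : ℝ)) = 8 * |t| ^ (-(1 / 2 : ℝ)) / |t| := by
    rw [mul_div_assoc]
    congr 1
    rw [eq_div_iff ht0.ne', show (-(1 / 2 : ℝ)) = -(3 / 2) + 1 by norm_num,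
      Real.rpow_add ht0, Real.rpow_one]
  rw [hpow, le_div_iff₀ ht0, e, step, norm_neg]
  exact hbound

/-! ## 6. The three-halves profile `P_L(x) = M(x) M(L - x)`: two integrations by parts -/

/-- `P_L(x) = M(x) M(L - x)` (the profile of `(cosh R - cosh r)^{3/2}`). [folklore] -/
def P3 (L x : ℝ) : ℝ := M3 x * M3 (L - x)

/-- `P_L'(x) = M'(x) M(L - x) - M(x) M'(L - x)`. [folklore] -/
def P3Deriv (L x : ℝ) : ℝ := M3Deriv x * M3 (L - x) - M3 x * M3Deriv (L - x)

/-- `P_L''(x) = M''(x) M(L - x) - 2 M'(x) M'(L - x) + M(x) M''(L - x)`. [folklore] -/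
def P3Deriv2 (L x : ℝ) : ℝ :=
  M3Deriv2 x * M3 (L - x) - 2 * (M3Deriv x * M3Deriv (L - x)) + M3 x * M3Deriv2 (L - x)

/-- The cross term is a multiple of the half-order profile:
`M'(x) M'(L - x) = (9/4) e^{-L} p_L(x)`. [folklore] -/
theorem M3Deriv_mul_M3Deriv (L x : ℝ) :
    M3Deriv x * M3Deriv (L - x) = 9 / 4 * Real.exp (-L) * pHalf L x := by
  unfold M3Deriv pHalf
  have : Real.exp (-x) * Real.exp (-(L - x)) = Real.exp (-L) := by
    rw [← Real.exp_add]; ring_nf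
  calc 3 / 2 * Real.exp (-x) * mHalf x * (3 / 2 * Real.exp (-(L - x)) * mHalf (L - x))
      = 9 / 4 * (Real.exp (-x) * Real.exp (-(L - x))) * (mHalf x * mHalf (L - x)) := by ring
    _ = _ := by rw [this]

/-- `x ↦ M(L - x)` has derivative `-M'(L - x)` for `x < L`. [folklore] -/
theorem hasDerivAt_M3_sub {x : ℝ} (hx : x < L) :
    HasDerivAt (fun x => M3 (L - x)) (-M3Deriv (L - x)) x := by
  have h2 : HasDerivAt (fun x => L - x) (-1) x := by simpa using (hasDerivAt_id x).const_sub L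
  have := (hasDerivAt_M3 (by linarith : 0 < L - x)).comp x h2
  refine this.congr_deriv (by ring)

/-- `x ↦ M'(L - x)` has derivative `-M''(L - x)` for `x < L`. [folklore] -/
theorem hasDerivAt_M3Deriv_sub {x : ℝ} (hx : x < L) :
    HasDerivAt (fun x => M3Deriv (L - x)) (-M3Deriv2 (L - x)) x := by
  have h2 : HasDerivAt (fun x => L - x) (-1) x := by simpa using (hasDerivAt_id x).const_sub L
  have := (hasDerivAt_M3Deriv (by linarith : 0 < L - x)).comp x h2
  refine this.congr_deriv (by ring)

/-- `M''` is integrable on `[0, c]`. [folklore] -/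
theorem intervalIntegrable_M3Deriv2 {c : ℝ} (hc : 0 ≤ c) : IntervalIntegrable M3Deriv2 volume 0 c := by
  have hdom : IntervalIntegrable (fun x : ℝ => 3 / 2 * x ^ (-(1 / 2 : ℝ))) volume 0 c :=
    (intervalIntegral.intervalIntegrable_rpow' (by norm_num)).const_mul _
  refine hdom.mono_fun' measurable_M3Deriv2.aestronglyMeasurable ?_
  rw [EventuallyLE, ae_restrict_iff' measurableSet_uIoc]
  refine ae_of_all _ (fun x hx => ?_)
  rw [uIoc_of_le hc] at hx
  rw [Real.norm_eq_abs]
  exact abs_M3Deriv2_le hx.1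

/-- `x ↦ M''(L - x)` is integrable on `[0, L]`. [folklore] -/
theorem intervalIntegrable_M3Deriv2_sub (hL : 0 ≤ L) :
    IntervalIntegrable (fun x => M3Deriv2 (L - x)) volume 0 L := by
  have := (intervalIntegrable_M3Deriv2 hL).comp_sub_left L
  simp only [sub_zero, sub_self] at this
  exact this.symm

/-- `∫_0^L M' = M(L)`. [folklore] -/
theorem integral_M3Deriv (hL : 0 ≤ L) : ∫ x in (0 : ℝ)..L, M3Deriv x = M3 L := by
  rw [intervalIntegral.integral_eq_sub_of_hasDerivAt_of_le hL continuous_M3.continuousOn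
    (fun x hx => hasDerivAt_M3 hx.1) (continuous_M3Deriv.intervalIntegrable _ _), M3_zero, sub_zero]

/-- The singular half of `P_L''`: `‖∫_0^L e^{ixt} M''(x) M(L - x) dx‖ ≤ (63/4) |t|^{-1/2}` (core lemma
with `A = 3/2`, `A' = 33/8`, `B = V = 1`). [folklore] -/
theorem norm_integral_cexp_M3Deriv2_mul_le (hL : 0 < L) (ht : 1 ≤ |t|) :
    ‖∫ x in (0 : ℝ)..L, Complex.exp (Complex.I * x * t) * ((M3Deriv2 x * M3 (L - x) : ℝ) : ℂ)‖ ≤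
      63 / 4 * |t| ^ (-(1 / 2 : ℝ)) := by
  have hV : ∫ x in (0 : ℝ)..L, |(-M3Deriv (L - x))| ≤ 1 := by
    have e : ∫ x in (0 : ℝ)..L, |(-M3Deriv (L - x))| = ∫ x in (0 : ℝ)..L, M3Deriv (L - x) := by
      refine intervalIntegral.integral_congr (fun x _ => ?_)
      simp only [abs_neg, abs_of_nonneg (M3Deriv_nonneg _)]
    rw [e, intervalIntegral.integral_comp_sub_left (fun x => M3Deriv x) L, sub_self, sub_zero,
      integral_M3Deriv hL.le]
    exact M3_le_one L
  have key := norm_integral_cexp_mul_singular_le (φ := M3Deriv2) (φ' := M3Deriv3)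
    (ψ := fun x => M3 (L - x)) (ψ' := fun x => -M3Deriv (L - x))
    (A := 3 / 2) (A' := 33 / 8) (B := 1) (V := 1) hL ht
    (fun x hx => hasDerivAt_M3Deriv2 hx) continuousOn_M3Deriv3
    (fun x hx => abs_M3Deriv2_le hx) (fun x hx => abs_M3Deriv3_le hx)
    ((continuous_M3.comp (continuous_const.sub continuous_id)).continuousOn)
    (fun x hx => hasDerivAt_M3_sub hx.2) (fun x _ => abs_M3_le_one _)
    ((continuous_M3Deriv.comp (continuous_const.sub continuous_id)).intervalIntegrable _ _).neg hV
  refine key.trans (le_of_eq ?_)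
  norm_num

/-- The mirror half: `‖∫_0^L e^{ixt} M(x) M''(L - x) dx‖ ≤ (63/4) |t|^{-1/2}`. [folklore] -/
theorem norm_integral_cexp_M3_mul_M3Deriv2_le (hL : 0 < L) (ht : 1 ≤ |t|) :
    ‖∫ x in (0 : ℝ)..L, Complex.exp (Complex.I * x * t) * ((M3 x * M3Deriv2 (L - x) : ℝ) : ℂ)‖ ≤
      63 / 4 * |t| ^ (-(1 / 2 : ℝ)) := by
  set G : ℝ → ℂ := fun y => Complex.exp (Complex.I * L * t) *
    (Complex.exp (Complex.I * y * (-t : ℝ)) * ((M3Deriv2 y * M3 (L - y) : ℝ) : ℂ)) with hG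
  have h1 : ∫ x in (0 : ℝ)..L, Complex.exp (Complex.I * x * t) * ((M3 x * M3Deriv2 (L - x) : ℝ) : ℂ) =
      ∫ x in (0 : ℝ)..L, G (L - x) := by
    refine intervalIntegral.integral_congr (fun x _ => ?_)
    simp only [hG, sub_sub_cancel]
    rw [mul_comm (M3Deriv2 (L - x)), ← mul_assoc, ← Complex.exp_add]
    congr 2
    push_cast
    ring
  have h2 : ∫ x in (0 : ℝ)..L, G (L - x) = ∫ x in (0 : ℝ)..L, G x := by
    rw [intervalIntegral.integral_comp_sub_left G L, sub_self, sub_zero]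
  rw [h1, h2, hG, intervalIntegral.integral_const_mul, norm_mul, norm_cexp_I_mul_real, one_mul]
  have ht' : 1 ≤ |(-t)| := by rwa [abs_neg]
  have := norm_integral_cexp_M3Deriv2_mul_le hL ht'
  rwa [abs_neg] at this

/-- **The three-halves oscillatory bound**: `‖∫_0^L e^{ixt} M(x) M(L - x) dx‖ ≤ (135/2) |t|^{-5/2}`
for real `|t| ≥ 1`, uniformly in `L ≥ 0` (two integrations by parts without boundary terms, since
`M(0) = M'(0) = 0`; the cross term `M'(x)M'(L - x) = (9/4) e^{-L} p_L(x)` is handled by the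
half-order bound). [folklore] -/
theorem norm_integral_cexp_P3_le (hL : 0 ≤ L) (ht : 1 ≤ |t|) :
    ‖∫ x in (0 : ℝ)..L, Complex.exp (Complex.I * x * t) * (P3 L x : ℂ)‖ ≤
      135 / 2 * |t| ^ (-(5 / 2 : ℝ)) := by
  have ht0 : 0 < |t| := lt_of_lt_of_le one_pos ht
  rcases hL.eq_or_lt with hL0 | hLpos
  · rw [← hL0, intervalIntegral.integral_same, norm_zero]; positivity
  have hcs : Continuous fun x : ℝ => L - x := continuous_const.sub continuous_id
  -- first integration by parts
  set v : ℝ → ℂ := fun x => (P3 L x : ℂ) with hv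
  set v' : ℝ → ℂ := fun x => (P3Deriv L x : ℂ) with hv'
  set v'' : ℝ → ℂ := fun x => (P3Deriv2 L x : ℂ) with hv''
  have hP3c : Continuous (P3 L) := by
    unfold P3; exact continuous_M3.mul (continuous_M3.comp hcs)
  have hP3Dc : Continuous (P3Deriv L) := by
    unfold P3Deriv
    exact (continuous_M3Deriv.mul (continuous_M3.comp hcs)).sub
      (continuous_M3.mul (continuous_M3Deriv.comp hcs))
  have hvc : ContinuousOn v (Icc 0 L) := (Complex.continuous_ofReal.comp hP3c).continuousOn
  have hvv' : ∀ x ∈ Ioo 0 L, HasDerivAt v (v' x) x := by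
    intro x hx
    have hreal : HasDerivAt (P3 L) (P3Deriv L x) x := by
      have := (hasDerivAt_M3 hx.1).mul (hasDerivAt_M3_sub hx.2)
      have h2 : P3 L = (M3 * fun x => M3 (L - x)) := funext fun y => rfl
      rw [h2]
      exact this.congr_deriv (by unfold P3Deriv; ring)
    rw [hv, hv']
    exact hreal.ofReal_comp
  have hv'i : IntervalIntegrable v' volume 0 L :=
    (Complex.continuous_ofReal.comp hP3Dc).intervalIntegrable _ _
  have step1 := integral_cexp_mul_eq hL (t : ℂ) hvc hvv' hv'i
  have hb0 : v 0 = 0 := by simp [hv, P3, M3_zero]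
  have hbL : v L = 0 := by simp [hv, P3, M3_zero]
  rw [hb0, hbL, mul_zero, mul_zero, sub_zero, zero_sub] at step1
  -- second integration by parts
  have hv'c : ContinuousOn v' (Icc 0 L) := (Complex.continuous_ofReal.comp hP3Dc).continuousOn
  have hv'v'' : ∀ x ∈ Ioo 0 L, HasDerivAt v' (v'' x) x := by
    intro x hx
    have hreal : HasDerivAt (P3Deriv L) (P3Deriv2 L x) x := by
      have := ((hasDerivAt_M3Deriv hx.1).mul (hasDerivAt_M3_sub hx.2)).sub
        ((hasDerivAt_M3 hx.1).mul (hasDerivAt_M3Deriv_sub hx.2))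
      have h2 : P3Deriv L = ((M3Deriv * fun x => M3 (L - x)) - M3 * fun x => M3Deriv (L - x)) :=
        funext fun y => rfl
      rw [h2]
      exact this.congr_deriv (by unfold P3Deriv2; ring)
    rw [hv', hv'']
    exact hreal.ofReal_comp
  have hIA : IntervalIntegrable (fun x => M3Deriv2 x * M3 (L - x)) volume 0 L :=
    (intervalIntegrable_M3Deriv2 hL).mul_continuousOn (continuous_M3.comp hcs).continuousOn
  have hIB : IntervalIntegrable (fun x => M3Deriv x * M3Deriv (L - x)) volume 0 L :=
    (continuous_M3Deriv.mul (continuous_M3Deriv.comp hcs)).intervalIntegrable _ _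
  have hIC : IntervalIntegrable (fun x => M3 x * M3Deriv2 (L - x)) volume 0 L :=
    (intervalIntegrable_M3Deriv2_sub hL).continuousOn_mul continuous_M3.continuousOn
  have hv''i : IntervalIntegrable v'' volume 0 L := by
    have := intervalIntegrable_ofReal ((hIA.sub (hIB.const_mul 2)).add hIC)
    rw [hv'']
    refine this.congr (fun x _ => ?_)
    simp only [P3Deriv2]
  have step2 := integral_cexp_mul_eq hL (t : ℂ) hv'c hv'v'' hv''i
  have hb0' : v' 0 = 0 := by simp [hv', P3Deriv, M3_zero, M3Deriv_zero]
  have hbL' : v' L = 0 := by simp [hv', P3Deriv, M3_zero, M3Deriv_zero]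
  rw [hb0', hbL', mul_zero, mul_zero, sub_zero, zero_sub] at step2
  -- `(it)² ∫ e v = ∫ e v''`
  have hsq : (Complex.I * t) * ((Complex.I * t) * ∫ x in (0 : ℝ)..L, Complex.exp (Complex.I * x * t) * v x) =
      ∫ x in (0 : ℝ)..L, Complex.exp (Complex.I * x * t) * v'' x := by
    rw [step1, mul_neg, step2, neg_neg]
  -- the three pieces of `v''`
  have eA : IntervalIntegrable (fun x => Complex.exp (Complex.I * x * t) *
      ((M3Deriv2 x * M3 (L - x) : ℝ) : ℂ)) volume 0 L :=
    (intervalIntegrable_ofReal hIA).continuousOn_mul (continuous_cexp_mul (t : ℂ)).continuousOn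
  have eB : IntervalIntegrable (fun x => Complex.exp (Complex.I * x * t) * (pHalf L x : ℂ)) volume 0 L := by
    have hpc : Continuous (pHalf L) := by
      unfold pHalf; exact continuous_mHalf.mul (continuous_mHalf.comp hcs)
    exact ((continuous_cexp_mul (t : ℂ)).mul (Complex.continuous_ofReal.comp hpc)).intervalIntegrable _ _
  have eC : IntervalIntegrable (fun x => Complex.exp (Complex.I * x * t) *
      ((M3 x * M3Deriv2 (L - x) : ℝ) : ℂ)) volume 0 L :=
    (intervalIntegrable_ofReal hIC).continuousOn_mul (continuous_cexp_mul (t : ℂ)).continuousOn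
  have hsplit : ∫ x in (0 : ℝ)..L, Complex.exp (Complex.I * x * t) * v'' x =
      (∫ x in (0 : ℝ)..L, Complex.exp (Complex.I * x * t) * ((M3Deriv2 x * M3 (L - x) : ℝ) : ℂ)) -
        (9 / 2 * Real.exp (-L) : ℝ) * (∫ x in (0 : ℝ)..L, Complex.exp (Complex.I * x * t) * (pHalf L x : ℂ)) +
        ∫ x in (0 : ℝ)..L, Complex.exp (Complex.I * x * t) * ((M3 x * M3Deriv2 (L - x) : ℝ) : ℂ) := by
    rw [← intervalIntegral.integral_const_mul, ← intervalIntegral.integral_sub eA (eB.const_mul _),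
      ← intervalIntegral.integral_add (eA.sub (eB.const_mul _)) eC]
    refine intervalIntegral.integral_congr (fun x _ => ?_)
    simp only [hv'', P3Deriv2]
    rw [M3Deriv_mul_M3Deriv L x]
    push_cast
    ring
  have hbound : ‖∫ x in (0 : ℝ)..L, Complex.exp (Complex.I * x * t) * v'' x‖ ≤ 135 / 2 * |t| ^ (-(1 / 2 : ℝ)) := by
    rw [hsplit]
    have hA := norm_integral_cexp_M3Deriv2_mul_le hLpos ht
    have hC := norm_integral_cexp_M3_mul_M3Deriv2_le hLpos ht
    have hB := norm_integral_cexp_pHalf_le hL ht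
    have hexp : ‖((9 / 2 * Real.exp (-L) : ℝ) : ℂ)‖ ≤ 9 / 2 := by
      rw [Complex.norm_real, Real.norm_of_nonneg (by positivity)]
      have : Real.exp (-L) ≤ 1 := Real.exp_le_one_iff.mpr (by linarith)
      linarith
    have hpow : |t| ^ (-(3 / 2 : ℝ)) ≤ |t| ^ (-(1 / 2 : ℝ)) :=
      Real.rpow_le_rpow_of_exponent_le ht (by norm_num)
    have hp0 : 0 ≤ |t| ^ (-(3 / 2 : ℝ)) := Real.rpow_nonneg ht0.le _
    calc _ ≤ ‖(∫ x in (0 : ℝ)..L, Complex.exp (Complex.I * x * t) * ((M3Deriv2 x * M3 (L - x) : ℝ) : ℂ)) -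
          (9 / 2 * Real.exp (-L) : ℝ) * (∫ x in (0 : ℝ)..L, Complex.exp (Complex.I * x * t) * (pHalf L x : ℂ))‖ +
          ‖∫ x in (0 : ℝ)..L, Complex.exp (Complex.I * x * t) * ((M3 x * M3Deriv2 (L - x) : ℝ) : ℂ)‖ :=
            norm_add_le _ _
      _ ≤ ‖∫ x in (0 : ℝ)..L, Complex.exp (Complex.I * x * t) * ((M3Deriv2 x * M3 (L - x) : ℝ) : ℂ)‖ +
          ‖((9 / 2 * Real.exp (-L) : ℝ) : ℂ)‖ * ‖∫ x in (0 : ℝ)..L, Complex.exp (Complex.I * x * t) * (pHalf L x : ℂ)‖ +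
          ‖∫ x in (0 : ℝ)..L, Complex.exp (Complex.I * x * t) * ((M3 x * M3Deriv2 (L - x) : ℝ) : ℂ)‖ := by
            gcongr
            exact (norm_sub_le _ _).trans (by rw [norm_mul])
      _ ≤ 63 / 4 * |t| ^ (-(1 / 2 : ℝ)) + 9 / 2 * (8 * |t| ^ (-(3 / 2 : ℝ))) + 63 / 4 * |t| ^ (-(1 / 2 : ℝ)) := by
            gcongr
      _ ≤ 63 / 4 * |t| ^ (-(1 / 2 : ℝ)) + 9 / 2 * (8 * |t| ^ (-(1 / 2 : ℝ))) + 63 / 4 * |t| ^ (-(1 / 2 : ℝ)) := by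
            gcongr
      _ = 135 / 2 * |t| ^ (-(1 / 2 : ℝ)) := by ring
  -- divide by `|t|²`
  have hIt : ‖Complex.I * (t : ℂ)‖ = |t| := by
    rw [norm_mul, Complex.norm_I, one_mul, Complex.norm_real, Real.norm_eq_abs]
  have e : ‖∫ x in (0 : ℝ)..L, Complex.exp (Complex.I * x * t) * v x‖ * |t| ^ 2 =
      ‖(Complex.I * t) * ((Complex.I * t) * ∫ x in (0 : ℝ)..L, Complex.exp (Complex.I * x * t) * v x)‖ := by
    rw [norm_mul, hIt, norm_mul, hIt]
    ring
  have ht2 : 0 < |t| ^ 2 := by positivity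
  have hpow : 135 / 2 * |t| ^ (-(5 / 2 : ℝ)) = 135 / 2 * |t| ^ (-(1 / 2 : ℝ)) / |t| ^ 2 := by
    rw [mul_div_assoc]
    congr 1
    rw [eq_div_iff ht2.ne', show (-(1 / 2 : ℝ)) = -(5 / 2) + 2 by norm_num,
      Real.rpow_add ht0, Real.rpow_two]
  rw [hpow, le_div_iff₀ ht2, e, hsq]
  exact hbound


/-! ## 7. The profiles in the shifted variable `ρ = r + R` -/

variable {R : ℝ}

/-- For `R ≥ 0` and `0 ≤ ρ ≤ 2R`: `√(cosh R - cosh(ρ - R)) = √(e^R/2) · m(ρ) m(2R - ρ)` (the exact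
factorisation `cosh R - cosh r = (e^R/2)(1 - e^{r-R})(1 - e^{-r-R})`). [folklore] -/
theorem sqrt_cosh_sub_cosh_shift (hR : 0 ≤ R) {ρ : ℝ} (hρ : ρ ∈ Icc 0 (2 * R)) :
    Real.sqrt (cosh R - cosh (ρ - R)) = Real.sqrt (Real.exp R / 2) * pHalf (2 * R) ρ := by
  have h := sub_cosh_shift (Real.one_le_cosh R) ρ
  rw [Real.arcosh_cosh hR] at h
  rw [h]
  have hE : 0 ≤ Real.exp R / 2 := by positivity
  have h1 : 0 ≤ 1 - Real.exp (ρ - 2 * R) := by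
    have : Real.exp (ρ - 2 * R) ≤ 1 := Real.exp_le_one_iff.mpr (by linarith [hρ.2])
    linarith
  have e2 : Real.exp (ρ - 2 * R) = Real.exp (-(2 * R - ρ)) := by congr 1; ring
  rw [Real.sqrt_mul hE, Real.sqrt_mul h1, e2]
  unfold pHalf mHalf
  ring

/-- The cube: `(cosh R - cosh(ρ - R))_+^{3/2} = √(e^R/2)³ · P_{2R}(ρ)`. [folklore] -/
theorem coshKernel_shift (hR : 0 ≤ R) {ρ : ℝ} (hρ : ρ ∈ Icc 0 (2 * R)) :
    coshKernel R (ρ - R) = Real.sqrt (Real.exp R / 2) ^ 3 * P3 (2 * R) ρ := by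
  rw [coshKernel, sqrt_cosh_sub_cosh_shift hR hρ, mul_pow]
  unfold P3 pHalf M3
  ring

/-- **`F_R` in the shifted variable**:
`F_R(t) = √(e^R/2)³ e^{-iRt} ∫_0^{2R} e^{iρt} M(ρ) M(2R - ρ) dρ`. [folklore] -/
theorem coshKernelFourier_eq_P3 (hR : 0 ≤ R) (t : ℝ) :
    coshKernelFourier R t = ((Real.sqrt (Real.exp R / 2) ^ 3 : ℝ) : ℂ) *
      Complex.exp (Complex.I * (-R : ℝ) * t) *
      ∫ ρ in (0 : ℝ)..2 * R, Complex.exp (Complex.I * ρ * t) * (P3 (2 * R) ρ : ℂ) := by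
  unfold coshKernelFourier
  have hsub := intervalIntegral.integral_comp_sub_right
    (fun r : ℝ => Complex.exp (Complex.I * r * t) * (coshKernel R r : ℂ)) R (a := 0) (b := 2 * R)
  rw [zero_sub, show 2 * R - R = R by ring] at hsub
  rw [← hsub, mul_assoc, ← intervalIntegral.integral_const_mul, ← intervalIntegral.integral_const_mul]
  refine intervalIntegral.integral_congr (fun ρ hρ => ?_)
  rw [uIcc_of_le (by linarith)] at hρ
  rw [coshKernel_shift hR hρ]
  push_cast
  rw [show Complex.I * ((ρ : ℂ) - R) * t = Complex.I * (-(R : ℂ)) * t + Complex.I * ρ * t by ring,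
    Complex.exp_add]
  ring

/-- **The uniform decay of `F_R` on the real line**: `‖F_R(t)‖ ≤ (135/2) √(e^R/2)³ |t|^{-5/2}` for
real `|t| ≥ 1`, uniformly in `R ≥ 0`. [folklore] -/
theorem norm_coshKernelFourier_le_uniform (hR : 0 ≤ R) {t : ℝ} (ht : 1 ≤ |t|) :
    ‖coshKernelFourier R t‖ ≤ 135 / 2 * Real.sqrt (Real.exp R / 2) ^ 3 * |t| ^ (-(5 / 2 : ℝ)) := by
  rw [coshKernelFourier_eq_P3 hR t, norm_mul, norm_mul, norm_cexp_I_mul_real, mul_one, Complex.norm_real,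
    Real.norm_of_nonneg (by positivity)]
  have h := norm_integral_cexp_P3_le (by linarith : 0 ≤ 2 * R) ht
  have h0 : 0 ≤ Real.sqrt (Real.exp R / 2) ^ 3 := by positivity
  calc _ ≤ Real.sqrt (Real.exp R / 2) ^ 3 * (135 / 2 * |t| ^ (-(5 / 2 : ℝ))) :=
        mul_le_mul_of_nonneg_left h h0
    _ = _ := by ring

/-- `G_R(t) = ∫_{-R}^{R} e^{irt} (cosh R - cosh r)^{1/2} dr` (real `t`): the Fourier integral of the
half-order profile, `= (2/3) ∂F/∂(cosh R)`. [folklore] -/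
def sqrtCoshFourier (R t : ℝ) : ℂ :=
  ∫ r in (-R)..R, Complex.exp (Complex.I * r * t) * (Real.sqrt (cosh R - cosh r) : ℂ)

/-- `G_R` in the shifted variable: `G_R(t) = √(e^R/2) e^{-iRt} ∫_0^{2R} e^{iρt} m(ρ) m(2R - ρ) dρ`. [folklore] -/
theorem sqrtCoshFourier_eq_pHalf (hR : 0 ≤ R) (t : ℝ) :
    sqrtCoshFourier R t = ((Real.sqrt (Real.exp R / 2) : ℝ) : ℂ) *
      Complex.exp (Complex.I * (-R : ℝ) * t) *
      ∫ ρ in (0 : ℝ)..2 * R, Complex.exp (Complex.I * ρ * t) * (pHalf (2 * R) ρ : ℂ) := by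
  unfold sqrtCoshFourier
  have hsub := intervalIntegral.integral_comp_sub_right
    (fun r : ℝ => Complex.exp (Complex.I * r * t) * (Real.sqrt (cosh R - cosh r) : ℂ)) R (a := 0) (b := 2 * R)
  rw [zero_sub, show 2 * R - R = R by ring] at hsub
  rw [← hsub, mul_assoc, ← intervalIntegral.integral_const_mul, ← intervalIntegral.integral_const_mul]
  refine intervalIntegral.integral_congr (fun ρ hρ => ?_)
  rw [uIcc_of_le (by linarith)] at hρ
  rw [sqrt_cosh_sub_cosh_shift hR hρ]
  push_cast
  rw [show Complex.I * ((ρ : ℂ) - R) * t = Complex.I * (-(R : ℂ)) * t + Complex.I * ρ * t by ring,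
    Complex.exp_add]
  ring

/-- **The uniform decay of `G_R`**: `‖G_R(t)‖ ≤ 8 √(e^R/2) |t|^{-3/2}` for real `|t| ≥ 1`. [folklore] -/
theorem norm_sqrtCoshFourier_le (hR : 0 ≤ R) {t : ℝ} (ht : 1 ≤ |t|) :
    ‖sqrtCoshFourier R t‖ ≤ 8 * Real.sqrt (Real.exp R / 2) * |t| ^ (-(3 / 2 : ℝ)) := by
  rw [sqrtCoshFourier_eq_pHalf hR t, norm_mul, norm_mul, norm_cexp_I_mul_real, mul_one, Complex.norm_real,
    Real.norm_of_nonneg (Real.sqrt_nonneg _)]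
  have h := norm_integral_cexp_pHalf_le (by linarith : 0 ≤ 2 * R) ht
  have h0 : 0 ≤ Real.sqrt (Real.exp R / 2) := Real.sqrt_nonneg _
  calc _ ≤ Real.sqrt (Real.exp R / 2) * (8 * |t| ^ (-(3 / 2 : ℝ))) := mul_le_mul_of_nonneg_left h h0
    _ = _ := by ring

/-- The trivial bound `‖G_R(t)‖ ≤ 2R √(e^R/2)` (all real `t`). [folklore] -/
theorem norm_sqrtCoshFourier_le_trivial (hR : 0 ≤ R) (t : ℝ) :
    ‖sqrtCoshFourier R t‖ ≤ Real.sqrt (Real.exp R / 2) * (2 * R) := by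
  rw [sqrtCoshFourier_eq_pHalf hR t, norm_mul, norm_mul, norm_cexp_I_mul_real, mul_one, Complex.norm_real,
    Real.norm_of_nonneg (Real.sqrt_nonneg _)]
  apply mul_le_mul_of_nonneg_left _ (Real.sqrt_nonneg _)
  have h : ‖∫ ρ in (0 : ℝ)..2 * R, Complex.exp (Complex.I * ρ * t) * (pHalf (2 * R) ρ : ℂ)‖ ≤ 1 * |2 * R - 0| := by
    apply intervalIntegral.norm_integral_le_of_norm_le_const
    intro x _
    rw [norm_mul, norm_cexp_I_mul_real, one_mul, Complex.norm_real, Real.norm_eq_abs]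
    exact abs_pHalf_le_one _ _
  rw [sub_zero, abs_of_nonneg (by linarith), one_mul] at h
  exact h

/-! ## 8. `Φ_C(t) = ∫ e^{irt} (C - cosh r)_+^{3/2} dr` and its `C`-derivative `(3/2) 𝒢_C(t)` -/

variable {C : ℝ}

/-- `Φ_C(t) = ∫_ℝ e^{irt} (C - cosh r)_+^{3/2} dr` (real `t`; `= F_{arcosh C}(t)` for `C ≥ 1`). [folklore] -/
def PhiC (C t : ℝ) : ℂ :=
  ∫ r : ℝ, Complex.exp (Complex.I * r * t) * ((Real.sqrt (C - cosh r) ^ 3 : ℝ) : ℂ)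

/-- `𝒢_C(t) = ∫_ℝ e^{irt} (C - cosh r)_+^{1/2} dr` (real `t`; `= G_{arcosh C}(t)` for `C ≥ 1`). [folklore] -/
def GLineC (C t : ℝ) : ℂ :=
  ∫ r : ℝ, Complex.exp (Complex.I * r * t) * (Real.sqrt (C - cosh r) : ℂ)

/-- `Φ_C(t) = F_{arcosh C}(t)` for `C ≥ 1`. [folklore] -/
theorem PhiC_eq_coshKernelFourier (hC : 1 ≤ C) (t : ℝ) :
    PhiC C t = coshKernelFourier (Real.arcosh C) t := by
  rw [← integral_cexp_mul_coshKernel (Real.arcosh_nonneg hC)]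
  unfold PhiC coshKernel
  rw [Real.cosh_arcosh hC]

/-- `𝒢_C(t) = G_{arcosh C}(t)` for `C ≥ 1` (the integrand vanishes off `[-arcosh C, arcosh C]`). [folklore] -/
theorem GLineC_eq_sqrtCoshFourier (hC : 1 ≤ C) (t : ℝ) :
    GLineC C t = sqrtCoshFourier (Real.arcosh C) t := by
  unfold GLineC sqrtCoshFourier
  have hR0 : 0 ≤ Real.arcosh C := Real.arcosh_nonneg hC
  rw [Real.cosh_arcosh hC, intervalIntegral.integral_of_le (by linarith : -Real.arcosh C ≤ Real.arcosh C),
    ← integral_Icc_eq_integral_Ioc, ← setIntegral_eq_integral_of_forall_compl_eq_zero]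
  intro r hr
  have h : Real.arcosh C ≤ |r| :=
    le_of_not_gt fun hlt => hr ⟨(abs_lt.mp hlt).1.le, (abs_lt.mp hlt).2.le⟩
  rw [sqrt_sub_cosh_eq_zero_of_le hR0 (by rw [Real.cosh_arcosh hC]) h]
  simp

/-- `e^{irt} g(r)` is integrable over `ℝ` when the real function `g` is (real `t`). [folklore] -/
theorem integrable_cexp_mul_ofReal {g : ℝ → ℝ} (hg : Integrable g) (t : ℝ) :
    Integrable (fun r : ℝ => Complex.exp (Complex.I * r * t) * (g r : ℂ)) := by
  refine hg.ofReal.bdd_mul (c := 1) (continuous_cexp_mul (t : ℂ)).aestronglyMeasurable ?_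
  exact ae_of_all _ (fun r => (norm_cexp_I_mul_real r t).le)

/-- **`∂Φ_C/∂C = (3/2) 𝒢_C`** (differentiation under the integral sign, dominated on `|C' - C| < 1`
by `(3/2) √(C + 1 - cosh r)`). [folklore] -/
theorem hasDerivAt_PhiC (C t : ℝ) : HasDerivAt (fun C => PhiC C t) (3 / 2 * GLineC C t) C := by
  have hint3 : Integrable (fun r => Real.sqrt (C - cosh r) ^ 3) := by
    have := integrable_exp_mul_sqrt_sub_cosh_pow 0 C
    refine this.congr (ae_of_all _ fun r => ?_)
    simp
  have hint1 : ∀ C : ℝ, Integrable (fun r => Real.sqrt (C - cosh r)) := by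
    intro C
    have := integrable_exp_mul_sqrt_sub_cosh 0 C
    refine this.congr (ae_of_all _ fun r => ?_)
    simp
  have key := hasDerivAt_integral_of_dominated_loc_of_deriv_le (μ := volume) (x₀ := C)
    (F := fun x r => Complex.exp (Complex.I * r * t) * ((Real.sqrt (x - cosh r) ^ 3 : ℝ) : ℂ))
    (F' := fun x r => Complex.exp (Complex.I * r * t) * ((3 / 2 * Real.sqrt (x - cosh r) : ℝ) : ℂ))
    (bound := fun r => 3 / 2 * Real.sqrt (C + 1 - cosh r))
    (s := Metric.ball C 1) (Metric.ball_mem_nhds C one_pos)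
    (Eventually.of_forall fun x => (by fun_prop : Continuous fun r : ℝ =>
      Complex.exp (Complex.I * r * t) * ((Real.sqrt (x - cosh r) ^ 3 : ℝ) : ℂ)).aestronglyMeasurable)
    (integrable_cexp_mul_ofReal hint3 t)
    ((by fun_prop : Continuous fun r : ℝ =>
      Complex.exp (Complex.I * r * t) * ((3 / 2 * Real.sqrt (C - cosh r) : ℝ) : ℂ)).aestronglyMeasurable)
    (ae_of_all _ fun r x hx => by
      have hx' : x ≤ C + 1 := by
        have := Metric.mem_ball.mp hx; rw [Real.dist_eq] at this; linarith [abs_lt.mp this]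
      rw [norm_mul, norm_cexp_I_mul_real, one_mul, Complex.norm_real, Real.norm_eq_abs,
        abs_of_nonneg (by positivity)]
      gcongr)
    (((hint1 (C + 1)).const_mul (3 / 2)))
    (ae_of_all _ fun r x _ => by
      have := ((hasDerivAt_sqrt_sub_pow_three (cosh r) x).ofReal_comp).const_mul
        (Complex.exp (Complex.I * r * t))
      exact this)
  have e : ∫ r : ℝ, Complex.exp (Complex.I * r * t) * ((3 / 2 * Real.sqrt (C - cosh r) : ℝ) : ℂ) =
      3 / 2 * GLineC C t := by
    unfold GLineC
    rw [← MeasureTheory.integral_const_mul]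
    congr 1 with r
    push_cast
    ring
  rw [← e]
  exact key.2

/-- **Mean value inequality in `C`**: if `‖(3/2) 𝒢_C(t)‖ ≤ K` for `C ∈ [a, b]`, then
`‖Φ_b(t) - Φ_a(t)‖ ≤ K (b - a)`. [folklore] -/
theorem norm_PhiC_sub_le {a b K t : ℝ} (hab : a ≤ b)
    (hK : ∀ C ∈ Icc a b, ‖(3 / 2 : ℂ) * GLineC C t‖ ≤ K) :
    ‖PhiC b t - PhiC a t‖ ≤ K * (b - a) := by
  have h := norm_image_sub_le_of_norm_deriv_le_segment' (f := fun C => PhiC C t)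
    (f' := fun C => (3 / 2 : ℂ) * GLineC C t) (a := a) (b := b) (C := K)
    (fun x _ => (hasDerivAt_PhiC x t).hasDerivWithinAt) (fun x hx => hK x (Ico_subset_Icc_self hx))
  exact h b ⟨hab, le_rfl⟩

/-! ## 9. Bounds in terms of `C` -/

/-- `√(e^{arcosh C}/2) ≤ √C` (as `e^{arcosh C} ≤ 2C`). [folklore] -/
theorem sqrt_exp_arcosh_div_two_le (hC : 1 ≤ C) :
    Real.sqrt (Real.exp (Real.arcosh C) / 2) ≤ Real.sqrt C :=
  Real.sqrt_le_sqrt (by linarith [exp_arcosh_le hC])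

/-- `arcosh C ≤ log(2C)` for `C ≥ 1`. [folklore] -/
theorem arcosh_le_log (hC : 1 ≤ C) : Real.arcosh C ≤ Real.log (2 * C) := by
  have h := exp_arcosh_le hC
  calc Real.arcosh C = Real.log (Real.exp (Real.arcosh C)) := (Real.log_exp _).symm
    _ ≤ Real.log (2 * C) := Real.log_le_log (Real.exp_pos _) h

/-- `‖F_{arcosh C}(t)‖ ≤ (135/2) (√C)³ |t|^{-5/2}` for `C ≥ 1`, real `|t| ≥ 1`. [folklore] -/
theorem norm_coshKernelFourier_arcosh_le (hC : 1 ≤ C) {t : ℝ} (ht : 1 ≤ |t|) :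
    ‖coshKernelFourier (Real.arcosh C) t‖ ≤ 135 / 2 * Real.sqrt C ^ 3 * |t| ^ (-(5 / 2 : ℝ)) := by
  refine (norm_coshKernelFourier_le_uniform (Real.arcosh_nonneg hC) ht).trans ?_
  have h := sqrt_exp_arcosh_div_two_le hC
  have h0 : 0 ≤ |t| ^ (-(5 / 2 : ℝ)) := Real.rpow_nonneg (abs_nonneg _) _
  gcongr

/-- `‖𝒢_C(t)‖ ≤ 8 √C |t|^{-3/2}` for `C ≥ 1`, real `|t| ≥ 1`. [folklore] -/
theorem norm_GLineC_le (hC : 1 ≤ C) {t : ℝ} (ht : 1 ≤ |t|) :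
    ‖GLineC C t‖ ≤ 8 * Real.sqrt C * |t| ^ (-(3 / 2 : ℝ)) := by
  rw [GLineC_eq_sqrtCoshFourier hC]
  refine (norm_sqrtCoshFourier_le (Real.arcosh_nonneg hC) ht).trans ?_
  have h := sqrt_exp_arcosh_div_two_le hC
  have h0 : 0 ≤ |t| ^ (-(3 / 2 : ℝ)) := Real.rpow_nonneg (abs_nonneg _) _
  gcongr

/-- `‖𝒢_C(t)‖ ≤ 2 √C log(2C)` for `C ≥ 1` and all real `t`. [folklore] -/
theorem norm_GLineC_le_log (hC : 1 ≤ C) (t : ℝ) :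
    ‖GLineC C t‖ ≤ 2 * Real.sqrt C * Real.log (2 * C) := by
  rw [GLineC_eq_sqrtCoshFourier hC]
  refine (norm_sqrtCoshFourier_le_trivial (Real.arcosh_nonneg hC) t).trans ?_
  have h1 := sqrt_exp_arcosh_div_two_le hC
  have h2 := arcosh_le_log hC
  have h3 : 0 ≤ Real.arcosh C := Real.arcosh_nonneg hC
  have h4 : 0 ≤ Real.sqrt C := Real.sqrt_nonneg _
  calc Real.sqrt (Real.exp (Real.arcosh C) / 2) * (2 * Real.arcosh C)
      ≤ Real.sqrt C * (2 * Real.log (2 * C)) := by gcongr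
    _ = _ := by ring

/-! ## 10. From `|t|`-powers to `|s|`-powers, `s = 1/2 + it` -/

/-- `(3/2)^{-3} = 8/27`. [folklore] -/
theorem three_halves_rpow_neg_three : (3 / 2 : ℝ) ^ (-3 : ℝ) = 8 / 27 := by
  rw [Real.rpow_neg (by norm_num), show (3 : ℝ) = ((3 : ℕ) : ℝ) by norm_num, Real.rpow_natCast]
  norm_num

/-- For `-3 ≤ p ≤ 0` and `|t| ≥ 1`: `|t|^p ≤ 4 |s|^p` (since `|s| ≤ |t| + 1/2 ≤ (3/2)|t|` and
`(3/2)^p ≥ 8/27 ≥ 1/4`). [folklore] -/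
theorem abs_rpow_le_specAbs_rpow {p t : ℝ} (hp : -3 ≤ p) (hp0 : p ≤ 0) (ht : 1 ≤ |t|) :
    |t| ^ p ≤ 4 * specAbs t ^ p := by
  have ht0 : 0 < |t| := lt_of_lt_of_le one_pos ht
  have hs : specAbs t ≤ 3 / 2 * |t| := by linarith [specAbs_le t]
  have hs0 := specAbs_pos t
  have h1 : (3 / 2 * |t|) ^ p ≤ specAbs t ^ p := Real.rpow_le_rpow_of_nonpos hs0 hs hp0
  rw [Real.mul_rpow (by norm_num) ht0.le] at h1
  have h2 : (3 / 2 : ℝ) ^ (-3 : ℝ) ≤ (3 / 2 : ℝ) ^ p :=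
    Real.rpow_le_rpow_of_exponent_le (by norm_num) hp
  rw [three_halves_rpow_neg_three] at h2
  have h3 : 0 ≤ |t| ^ p := Real.rpow_nonneg ht0.le _
  nlinarith

/-- For `|t| ≤ 1`: `1 ≤ 4 |s|^{-5/2}` (since `|s| ≤ 3/2`). [folklore] -/
theorem one_le_four_mul_specAbs_rpow {t : ℝ} (ht : |t| ≤ 1) : 1 ≤ 4 * specAbs t ^ (-(5 / 2 : ℝ)) := by
  have hs : specAbs t ≤ 3 / 2 := by linarith [specAbs_le t]
  have hs0 := specAbs_pos t
  have h1 : (3 / 2 : ℝ) ^ (-(5 / 2 : ℝ)) ≤ specAbs t ^ (-(5 / 2 : ℝ)) :=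
    Real.rpow_le_rpow_of_nonpos hs0 hs (by norm_num)
  have h2 : (3 / 2 : ℝ) ^ (-3 : ℝ) ≤ (3 / 2 : ℝ) ^ (-(5 / 2 : ℝ)) :=
    Real.rpow_le_rpow_of_exponent_le (by norm_num) (by norm_num)
  rw [three_halves_rpow_neg_three] at h2
  linarith

/-- `|s|^{-3/2} = |s|^{-5/2} |s|`. [folklore] -/
theorem specAbs_rpow_neg_three_half (t : ℝ) :
    specAbs t ^ (-(3 / 2 : ℝ)) = specAbs t ^ (-(5 / 2 : ℝ)) * specAbs t := by
  rw [show (-(3 / 2 : ℝ)) = -(5 / 2) + 1 by norm_num, Real.rpow_add (specAbs_pos t), Real.rpow_one]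

/-- If `|s| > 2` then `|t| ≥ 1`. [folklore] -/
theorem one_le_abs_of_two_lt_specAbs {t : ℝ} (h : 2 < specAbs t) : 1 ≤ |t| := by
  by_contra hlt
  push Not at hlt
  have := specAbs_le t
  linarith

end SelbergDecay

/-! ## 11. Assembly: (12.9) -/

open SelbergDecay in
/-- **Iwaniec (12.9) holds** (discharge of the named fact `Iwaniec2002_eq_12_9` of
`SelbergTransform.lean`): for `X ≥ 2Y ≥ 2` and real `t`,
`h(t) ≪ |s|^{-5/2} (min{|s|, T} + log X) X^{1/2}`, `T = X/Y`, `s = 1/2 + it`, with an absolute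
constant (here `1440 √2`). Proof: `h = (16/(3√2 Y))(F_{R_b} - F_{R_a})` (closed form); for
`|s| > T` each `F_R` is `≪ X^{3/2} |t|^{-5/2}` by the uniform decay of `F_R` (two integrations by
parts in the shifted variable), giving the term `T`; for `|s| ≤ T` the mean value inequality in
`C = cosh R ∈ [X/2, (X+Y)/2]` with `∂F/∂C = (3/2) 𝒢_C ≪ X^{1/2} min(|t|^{-3/2}, log X)` gives the
terms `|s|` and `log X`. [cite: Iwaniec2002, (12.9), PDF p. 126] -/
theorem Iwaniec2002_eq_12_9_holds : Iwaniec2002_eq_12_9 := by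
  refine ⟨1440 * Real.sqrt 2, fun X Y hY hXY t => ?_⟩
  have hX2 : 2 ≤ X := by linarith
  have hY0 : 0 < Y := by linarith
  have hX0 : 0 < X := by linarith
  set Ca : ℝ := X / 2 with hCa
  set Cb : ℝ := (X + Y) / 2 with hCb
  have hCa1 : 1 ≤ Ca := by rw [hCa]; linarith
  have hCab : Ca ≤ Cb := by rw [hCa, hCb]; linarith
  have hCb1 : 1 ≤ Cb := hCa1.trans hCab
  have hCbX : Cb ≤ X := by rw [hCb]; linarith
  have hsub : Cb - Ca = Y / 2 := by rw [hCa, hCb]; ring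
  have hsqX : Real.sqrt Cb ≤ Real.sqrt X := Real.sqrt_le_sqrt hCbX
  have hlogX : 0 ≤ Real.log X := Real.log_nonneg (by linarith)
  have hlog2 : Real.log (2 * Cb) ≤ 2 * Real.log X := by
    have h1 : Real.log (2 * Cb) ≤ Real.log (X ^ 2) := by
      apply Real.log_le_log (by linarith)
      nlinarith
    rwa [Real.log_pow, Nat.cast_ofNat] at h1
  have hsX0 : 0 ≤ Real.sqrt X := Real.sqrt_nonneg X
  have hs0 := specAbs_pos t
  have hs5 : 0 ≤ specAbs t ^ (-(5 / 2 : ℝ)) := Real.rpow_nonneg hs0.le _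
  have hT0 : 0 < X / Y := div_pos hX0 hY0
  have hmin0 : 0 ≤ min (specAbs t) (X / Y) := le_min hs0.le hT0.le
  -- the closed form
  rw [selbergTransform_latticeKernel hX2 hY0 (t : ℂ), norm_mul, Complex.norm_real,
    Real.norm_of_nonneg (by positivity), ← PhiC_eq_coshKernelFourier hCb1, ← PhiC_eq_coshKernelFourier hCa1]
  have hcoef : (16 / (3 * Y * Real.sqrt 2) : ℝ) = 8 * Real.sqrt 2 / (3 * Y) := by
    have hs2 : Real.sqrt 2 ≠ 0 := by positivity
    field_simp
    have : Real.sqrt 2 ^ 2 = 2 := Real.sq_sqrt (by norm_num)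
    nlinarith
  rw [hcoef]
  -- the majorant, unfolded
  have hmaj : majorant129 X Y t = specAbs t ^ (-(5 / 2 : ℝ)) * (min (specAbs t) (X / Y) + Real.log X) * Real.sqrt X := by
    rw [majorant129, Real.sqrt_eq_rpow]
  rw [hmaj]
  rcases le_or_gt (specAbs t) (X / Y) with hsT | hTs
  · -- `|s| ≤ T`: mean value inequality in `C`
    rw [min_eq_left hsT]
    rcases le_or_gt |t| 1 with ht1 | ht1
    · -- `|t| ≤ 1`: the trivial bound on `𝒢_C`, giving `√X log X`
      have hK : ∀ C ∈ Icc Ca Cb, ‖(3 / 2 : ℂ) * GLineC C t‖ ≤ 3 / 2 * (2 * Real.sqrt X * (2 * Real.log X)) := by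
        intro C hC
        have hC1 : 1 ≤ C := hCa1.trans hC.1
        rw [norm_mul, show ‖(3 / 2 : ℂ)‖ = 3 / 2 by norm_num]
        refine mul_le_mul_of_nonneg_left ((norm_GLineC_le_log hC1 t).trans ?_) (by norm_num)
        have h1 : Real.sqrt C ≤ Real.sqrt X := Real.sqrt_le_sqrt (hC.2.trans hCbX)
        have h2 : Real.log (2 * C) ≤ 2 * Real.log X := by
          refine le_trans (Real.log_le_log (by linarith) (by linarith [hC.2])) hlog2
        have h3 : 0 ≤ Real.log (2 * C) := Real.log_nonneg (by linarith)
        gcongr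
      have hmv := norm_PhiC_sub_le hCab hK
      rw [hsub] at hmv
      have h4 := one_le_four_mul_specAbs_rpow ht1
      calc 8 * Real.sqrt 2 / (3 * Y) * ‖PhiC Cb t - PhiC Ca t‖
          ≤ 8 * Real.sqrt 2 / (3 * Y) * (3 / 2 * (2 * Real.sqrt X * (2 * Real.log X)) * (Y / 2)) := by
            gcongr
        _ = 8 * Real.sqrt 2 * (1 * Real.log X * Real.sqrt X) := by field_simp
        _ ≤ 8 * Real.sqrt 2 * ((4 * specAbs t ^ (-(5 / 2 : ℝ))) * (specAbs t + Real.log X) * Real.sqrt X) := by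
            gcongr
            linarith
        _ = 32 * Real.sqrt 2 * (specAbs t ^ (-(5 / 2 : ℝ)) * (specAbs t + Real.log X) * Real.sqrt X) := by ring
        _ ≤ 1440 * Real.sqrt 2 * (specAbs t ^ (-(5 / 2 : ℝ)) * (specAbs t + Real.log X) * Real.sqrt X) :=
            mul_le_mul_of_nonneg_right
              (mul_le_mul_of_nonneg_right (by norm_num) (Real.sqrt_nonneg 2))
              (mul_nonneg (mul_nonneg hs5 (add_nonneg hs0.le hlogX)) hsX0)
    · -- `|t| ≥ 1`: the decay `𝒢_C ≪ √C |t|^{-3/2}`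
      have hK : ∀ C ∈ Icc Ca Cb, ‖(3 / 2 : ℂ) * GLineC C t‖ ≤ 3 / 2 * (8 * Real.sqrt X * |t| ^ (-(3 / 2 : ℝ))) := by
        intro C hC
        have hC1 : 1 ≤ C := hCa1.trans hC.1
        rw [norm_mul, show ‖(3 / 2 : ℂ)‖ = 3 / 2 by norm_num]
        refine mul_le_mul_of_nonneg_left ((norm_GLineC_le hC1 ht1.le).trans ?_) (by norm_num)
        have h1 : Real.sqrt C ≤ Real.sqrt X := Real.sqrt_le_sqrt (hC.2.trans hCbX)
        have h0 : 0 ≤ |t| ^ (-(3 / 2 : ℝ)) := Real.rpow_nonneg (abs_nonneg _) _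
        gcongr
      have hmv := norm_PhiC_sub_le hCab hK
      rw [hsub] at hmv
      have h4 := abs_rpow_le_specAbs_rpow (p := -(3 / 2 : ℝ)) (by norm_num) (by norm_num) ht1.le
      rw [specAbs_rpow_neg_three_half] at h4
      calc 8 * Real.sqrt 2 / (3 * Y) * ‖PhiC Cb t - PhiC Ca t‖
          ≤ 8 * Real.sqrt 2 / (3 * Y) * (3 / 2 * (8 * Real.sqrt X * |t| ^ (-(3 / 2 : ℝ))) * (Y / 2)) := by
            gcongr
        _ = 16 * Real.sqrt 2 * (|t| ^ (-(3 / 2 : ℝ)) * Real.sqrt X) := by field_simp; ring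
        _ ≤ 16 * Real.sqrt 2 * ((4 * (specAbs t ^ (-(5 / 2 : ℝ)) * specAbs t)) * Real.sqrt X) := by gcongr
        _ = 64 * Real.sqrt 2 * (specAbs t ^ (-(5 / 2 : ℝ)) * specAbs t * Real.sqrt X) := by ring
        _ ≤ 64 * Real.sqrt 2 * (specAbs t ^ (-(5 / 2 : ℝ)) * (specAbs t + Real.log X) * Real.sqrt X) :=
            mul_le_mul_of_nonneg_left
              (mul_le_mul_of_nonneg_right
                (mul_le_mul_of_nonneg_left (le_add_of_nonneg_right hlogX) hs5) hsX0)
              (by positivity)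
        _ ≤ 1440 * Real.sqrt 2 * (specAbs t ^ (-(5 / 2 : ℝ)) * (specAbs t + Real.log X) * Real.sqrt X) :=
            mul_le_mul_of_nonneg_right
              (mul_le_mul_of_nonneg_right (by norm_num) (Real.sqrt_nonneg 2))
              (mul_nonneg (mul_nonneg hs5 (add_nonneg hs0.le hlogX)) hsX0)
  · -- `|s| > T ≥ 2`: the uniform decay of each `F_R`, giving the term `T`
    rw [min_eq_right hTs.le]
    have hT2 : 2 ≤ X / Y := by rw [le_div_iff₀ hY0]; linarith
    have ht1 : 1 ≤ |t| := one_le_abs_of_two_lt_specAbs (lt_of_le_of_lt hT2 hTs)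
    have hFb := norm_coshKernelFourier_arcosh_le hCb1 ht1
    have hFa := norm_coshKernelFourier_arcosh_le hCa1 ht1
    rw [PhiC_eq_coshKernelFourier hCb1, PhiC_eq_coshKernelFourier hCa1]
    have hsqa : Real.sqrt Ca ^ 3 ≤ Real.sqrt X ^ 3 :=
      pow_le_pow_left₀ (Real.sqrt_nonneg _) (Real.sqrt_le_sqrt (hCab.trans hCbX)) 3
    have hsqb : Real.sqrt Cb ^ 3 ≤ Real.sqrt X ^ 3 := pow_le_pow_left₀ (Real.sqrt_nonneg _) hsqX 3
    have ht5 : 0 ≤ |t| ^ (-(5 / 2 : ℝ)) := Real.rpow_nonneg (abs_nonneg _) _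
    have h4 := abs_rpow_le_specAbs_rpow (p := -(5 / 2 : ℝ)) (by norm_num) (by norm_num) ht1
    have hX3 : Real.sqrt X ^ 3 = X * Real.sqrt X := by
      rw [pow_succ, Real.sq_sqrt hX0.le]
    calc 8 * Real.sqrt 2 / (3 * Y) * ‖coshKernelFourier (Real.arcosh Cb) t - coshKernelFourier (Real.arcosh Ca) t‖
        ≤ 8 * Real.sqrt 2 / (3 * Y) * (135 / 2 * Real.sqrt X ^ 3 * |t| ^ (-(5 / 2 : ℝ)) +
            135 / 2 * Real.sqrt X ^ 3 * |t| ^ (-(5 / 2 : ℝ))) := by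
          gcongr
          refine (norm_sub_le _ _).trans (add_le_add (hFb.trans ?_) (hFa.trans ?_))
          · gcongr
          · gcongr
      _ = 360 * Real.sqrt 2 * (|t| ^ (-(5 / 2 : ℝ)) * (X / Y) * Real.sqrt X) := by
          rw [hX3]; field_simp; ring
      _ ≤ 360 * Real.sqrt 2 * ((4 * specAbs t ^ (-(5 / 2 : ℝ))) * (X / Y) * Real.sqrt X) := by gcongr
      _ = 1440 * Real.sqrt 2 * (specAbs t ^ (-(5 / 2 : ℝ)) * (X / Y) * Real.sqrt X) := by ring
      _ ≤ 1440 * Real.sqrt 2 * (specAbs t ^ (-(5 / 2 : ℝ)) * (X / Y + Real.log X) * Real.sqrt X) := by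
          gcongr
          linarith

end Literature.NumberTheory.Automorphic
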